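import Summits.RiemannHypothesis.RiemannHypothesis.Theorems.TiltedLandingLaw421R3LandingDoor
import Summits.RiemannHypothesis.RiemannHypothesis.Theorems.TiltedLandingLaw421R3RateSplit
import Summits.RiemannHypothesis.RiemannHypothesis.Theorems.TiltedLandingLaw421R3RealCritClose
import Summits.RiemannHypothesis.RiemannHypothesis.Theses.EarlyAppointments

/-! # LENS-1 COVERAGE THEOREM v2 (rh33346-lens-1-g2) — a typed REGIME PARTITION of the scope of the SUCC law of record
`RhW08.LandingDoor.DoorAvailLawQ8`, one named lemma per regime, and the kernel-checked compositions

Crux (fixed, by name): `Summit.RiemannHypothesis.RiemannHypothesis.Theses.EarlyAppointments.TiltedLandingLaw421R`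
(registered skeleton `Cruxes/TiltedLandingLaw421R/Lines/trkD_v6q.lean`: `stub_doorAvailLawQ8`, `stub_rateLawsHalfQ`).
This file is the gen-2 object asked for by director-rh (CA443) and the lens-1 HANDOFF: it supersedes `Sketch-lens1-v8.lean` as the lens-1
working file (v8 §§4,6,7,8,9,10 are carried VERBATIM — hands PASS crit-1 g2 / desk g29 53/53 — and v8 §§1,3,5 (J2, the Q2/Q3/Q9/Q10 law
texts) are DROPPED here: J2/N♯/N♭ are helpers, not law-of-record candidates, by the door-integration rule CA441).

## The coordinates (frame-free, at the tracked state `v`, `y := Im v`, `K := RhW08.AntiEscapeSplit7.newtonK f j v`)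
* `ι := coverIndex f j v = y·Im K + ½`       — the COVER INDEX (signed Jensen potential read at `v`; (S1)+(R): `ι > 0` ⇔ some pair roofs `v`);
* `κ := fieldStrength f j v = ‖K‖·y`          — the FIELD STRENGTH;
* `Δ := κ² + ι − ½`                            — the (signed, scaled) HEIGHT OF THE NEWTON CHILD: `Im(v − K⁻¹)·κ² = y·Δ` ((B4));
* `endNumber f j v ρ₀`, `NewtonSep f j v ρ₀ δ` — the EXACT END number and the separation of the cofactor `dslope (f^{(j)}) v` at Newton
  scale `(1+ρ₀)/‖K‖` (the clauses of N♯/N♭ verbatim, now NAMED);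
* `ChildCornerSlack f x₀ R Hs j v ρ₀`         — band slack charged at the child's worst corner (N♭'s frame clause; in coordinates by (B6));
* `LandingDip f j v`                           — the REAL-TRACE landing indicator: a critical point `x⋆` of the trace of `f^{(j+1)}` within
  `2y` of `Re v` with `m·A > 0` (`m = f^{(j+1)}(x⋆)`, `2A = f^{(j+3)}(x⋆)`) = `LandingTaylor`'s data WITHOUT its radius/margin clauses.
  (The Newton-coordinate landing layer `|Δ| < 0.1` of regime-map v2 is DEAD — 0/41 rows, certified landing edge at `|Δ| = 1.10`; crit-1 CUT 2.)

## The cells (a COVER of every `(f, frame, j, v)` by construction — `cells_cover` is `lt_or_le` + excluded middle, no analysis)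
| cell | definition | regime lemma | status | owner of the open part | instrument observable at the boundary |
|---|---|---|---|---|---|
| COV | `0 < ι` | `RegCov8` (+ PROVED datum: a covering pair, `exists_cover_of_coverIndex_pos_frame`; localisation `roof_localisation_frame`) | OPEN | U (two-body roof pair) / C′ / W | sign ι; d₁ vs y·#S/(2ι); Im c/Im v of the nearest roof |
| F | N♯ window: `ρ₀ ≤ κ`, `2ι ≤ ρ₀²−2ρ₀κ`, `ρ₀κ ≤ Δ`, sep, `endNumber < ρ₀‖K‖` | `regime_F` | **PROVED** (successor) | — | K-A♯ with EXACT END (instr-1: 9/17 R0) |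
| N♭ | child fit: `0 < κ`, `ρ₀κ ≤ |Δ|`, sep, END, `ChildCornerSlack` | `regime_Nb` | **PROVED** (successor) | — | K-A♭ (instr-1: 17/17 R0) |
| L | `ι ≤ 0 ∧ ¬F ∧ ¬N♭ ∧ LandingDip` | `RegL8` (plug: `regL8_of_landingTaylorLaw`) | OPEN | L (`RhW08.LandingDoor.succ_of_landingTaylor`: radius + `M₃r³ < |m|` + depth) | dip data (x⋆, m, A, M₃) → Taylor margin |
| E | `ι ≤ 0 ∧ ¬F ∧ ¬N♭ ∧ ¬LandingDip` | `RegE8` | OPEN | U / C′ (close un-roofing neighbour at Newton scale: END heavy) | nearest-zero distance ·‖K‖, END(ρ₀)/ρ₀‖K‖ on the F-window |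

## The compositions (all sorry-free; §14)
* `doorAvailLawQ8_of_regimes : RegCov8 → RegF8 → RegNb8 → RegL8 → RegE8 → RhW08.LandingDoor.DoorAvailLawQ8` — the LITERAL object of CA443
  (five regime statements in Q8-door currency ⇒ the SUCC law of record).  HONEST STATUS: F and N♭ are proved in SUCCESSOR currency
  (`regime_F`, `regime_Nb` conclude `∃ u, StTrkDQ … (j+1) u` through doors N♯/N♭, which are NOT among the six Q8 doors — N♯ drops N's
  `1 < ‖K‖·Im v` and N5, its disc excludes `v` so it is no `ClusterNumbersU` instance), so `RegF8`/`RegNb8` are NOT discharged by this file (D1).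
* `antiEscapeCore_of_regimes : RealCritBoundNSig → RegCov8 → RegL8 → RegE8 → RhW08.SuccSplit.AntiEscapeCore` and
  `TiltedLandingLaw421R_of_regimes : RegCov8 → RegL8 → RegE8 → RhW08.RateSplit.RateLawsHalfQ → …Theses.EarlyAppointments.TiltedLandingLaw421R`
  — the crux BY NAME from THREE open regime statements (each strictly weaker than `DoorAvailLawQ8`: same binders, one extra CONFIGURATION
  hypothesis, same conclusion) + lens-2's rate stub; cells F and N♭ DISCHARGED.  This is the candidate skeleton v7q (§15: three `stub_*`,
  the only `sorry`s of the file) — to be registered by the lead/director, not by this seat.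
* `doorAvailLawQ8_implies_regimes`: conversely each `Reg*8` follows from `DoorAvailLawQ8` (so v7q's SUCC stubs are implied by v6q's).

Nothing here bears on the truth of RH; RH is not proved; 33346/33347 OPEN. 
## v2 (2026-08-30 ~20:15Z) — what changed against v1 (a284b7d11bf217c3)
* NEW §13b THE JENSEN DIP LEMMA (`jensenDip`, `jensenDip_pos`: real-axis dual of `Literature.Analysis.Complex.jensen_circle`, PROVED) and
  `succ_of_dip_deep` / `regime_Ldeep` (PROVED): a deep landing dip (`LandingDipDeep` = `LandingDip` ∧ `|xs − x₀| + Hs ≤ R/2`) yields a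
  successor by a SIGN argument — the third cell lemma discharged (after `regime_F`, `regime_Nb`).
* Cell L split: open `RegLedge8` (cell L, no deep dip) replaces `RegL8` in the successor-currency composition
  (`antiEscapeCore_of_regimes2`, `TiltedLandingLaw421R_of_regimes2 : RegCov8 → RegLedge8 → RegE8 → RateLawsHalfQ → crux`); `RegL8`,
  `doorAvailLawQ8_of_regimes` and the v1 compositions are kept verbatim (literal Q8 currency; `regLedge8_of_regL8`).
* §15 candidate skeleton is now v8q: `stub_regCov8`, `stub_regLedge8`, `stub_regE8`, `stub_rateLawsHalfQ` (the only sorries).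
-/
namespace Summit.RiemannHypothesis.RiemannHypothesis.Cruxes.TiltedLandingLaw421R.Lens1

set_option linter.dupNamespace false

open Complex Set
open scoped ComplexConjugate
open Literature.Analysis.Complex
open Summit.RiemannHypothesis.RiemannHypothesis.Theorems.Splittings.JensenWindow
open RhIdea6.G17.W07C7 RhIdea6.G17.W07C7.Rev6 RhIdea6.G18.W07C8.Law421BirthS RhIdea6.G19.W07C11.Seam
open RhIdea6.G20.W07C12.Frac RhIdea6.G20.W07C12.StColP RhW07.C12.FieldSplit RhIdea6.G21.W07C13.TentMax
open RhW07.C14.TwoSided RhW07.C14.Classes RhW07.C14.Lineage RhW07.C14.Booking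
open RhW07.C13.Heredity RhIdea6.G22.W07C15pre.Injection RhW07.E3.Cell RhW07.E3.Lit
open RhW08.Round1 RhW08.StSwap RhW08.Round2 RhW08.QuadW RhW08.SealSwapQ RhW08.SealSwap RhW08.SuccB RhW08.SuccSplit
open RhW08.SuccTheft RhW08.Column RhW08.Hurwitz RhW08.ClusterQ RhW08.ClusterQM RhW08.NewtonDoor RhW08.NewtonDoorGenusOne RhW08.PurseP
open RhW08.AntiEscapeSplit7

/-! ## §2 (from v8) PAIR TERM SIGN — the roof criterion (I1); tree: `RhW08.Lens1.pairField_im_pos_iff` (#1125, with an extra binder `c.im ≠ 0`) -/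

/-- PAIR TERM SIGN (PROVED; the textbook computation in Jensen's proof, read AT a zero): the conjugate pair `{c, c̄}` pushes the
field at `v` UPWARD iff `v` lies STRICTLY INSIDE the pair's Jensen disc `D(Re c, |Im c|)` — i.e. iff `c` is a ROOF over `v`. -/
theorem pairField_im_pos_iff {v c : ℂ} (hv : 0 < v.im) (h1 : c ≠ v) (h2 : c ≠ conj v) :
    0 < ((v - c)⁻¹ + (v - conj c)⁻¹).im ↔ (v.re - c.re) ^ 2 + v.im ^ 2 < c.im ^ 2 := by
  have hvc : v - c ≠ 0 := sub_ne_zero.mpr (Ne.symm h1)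
  have hvc' : v - conj c ≠ 0 := by
    intro h
    apply h2
    have : v = conj c := sub_eq_zero.mp h
    rw [this, Complex.conj_conj]
  have hn1 : 0 < Complex.normSq (v - c) := Complex.normSq_pos.mpr hvc
  have hn2 : 0 < Complex.normSq (v - conj c) := Complex.normSq_pos.mpr hvc'
  have e1 : Complex.normSq (v - c) = (v.re - c.re) ^ 2 + (v.im - c.im) ^ 2 := by
    rw [Complex.normSq_apply]; simp [Complex.sub_re, Complex.sub_im]; ring
  have e2 : Complex.normSq (v - conj c) = (v.re - c.re) ^ 2 + (v.im + c.im) ^ 2 := by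
    rw [Complex.normSq_apply]; simp [Complex.sub_re, Complex.sub_im, Complex.conj_re, Complex.conj_im]; ring
  have him : ((v - c)⁻¹ + (v - conj c)⁻¹).im
      = (-2 * v.im * ((v.re - c.re) ^ 2 + v.im ^ 2 - c.im ^ 2)) /
          (Complex.normSq (v - c) * Complex.normSq (v - conj c)) := by
    rw [Complex.add_im, Complex.inv_im, Complex.inv_im, div_add_div _ _ hn1.ne' hn2.ne']
    congr 1
    simp only [Complex.sub_im, Complex.conj_im]
    rw [e1, e2]; ring
  rw [him]
  have hden : 0 < Complex.normSq (v - c) * Complex.normSq (v - conj c) := mul_pos hn1 hn2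
  rw [div_pos_iff_of_pos_right hden]
  constructor
  · intro h
    nlinarith [mul_pos hv hv]
  · intro h
    have : 0 < c.im ^ 2 - ((v.re - c.re) ^ 2 + v.im ^ 2) := by linarith
    nlinarith [mul_pos hv this]

/-! ## §4 Door N♯ (idea `signed-jensen-floor`, typed consequence of (I2)): the Newton door with the scalar slack N5 AND the
regime clause `1 < ‖K‖·Im v` both REPLACED by ONE geometric clause — the Newton disc lies inside `v`'s own closed Jensen disc
`D̄(Re v, Im v)`; band membership of the successor is then Jensen nesting (`RhW08.QuadW.band_of_hang`), charged at the CHILD's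
position, not at `Im v + (1+ρ₀)/‖K‖`.  By (I2) the clause is the un-roofed ⁄ floor-dominant regime `Im K_ext ≤ −(margin)`. -/

/-- The Newton door chain of `RhW08.NewtonDoor` with the WHOLE-DISC band clause `hdisc` kept abstract (Lipschitz form). -/
theorem succ_of_newton_door_lip_disc {η : ℝ} {f : ℂ → ℂ} {x₀ s hmax R Hs : ℝ} {B j : ℕ} {v : ℂ}
    (hE : EngineHyps5 2 η f x₀ s hmax R Hs B) (hv : StTrkDQ η f x₀ s hmax R Hs B j v) {K : ℂ} (hK : K ≠ 0)
    {ρ₀ Λ : ℝ} (hρ₀ : 0 < ρ₀) (hΛ : (1 + ρ₀) * Λ < ρ₀ * ‖K‖) (hoff : ρ₀ / ‖K‖ ≤ |(v - K⁻¹).im|)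
    (hh0 : ∀ z : ℂ, ‖z - (v - K⁻¹)‖ ≤ ρ₀ / ‖K‖ → dslope (iteratedDeriv j f) v z ≠ 0)
    (hlip : ∀ z : ℂ, ‖z - (v - K⁻¹)‖ = ρ₀ / ‖K‖ →
      ‖deriv (dslope (iteratedDeriv j f) v) z / dslope (iteratedDeriv j f) v z - K‖ ≤ Λ)
    (hdisc : ∀ z : ℂ, ‖z - (v - K⁻¹)‖ < ρ₀ / ‖K‖ → |z.im| ≤ Hs →
      (max (|z.re - x₀| - R / 2) 0) ^ 2 + ((j : ℝ) + 1) * z.im ^ 2 ≤ ((j : ℝ) + 1) * Hs ^ 2) :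
    ∃ u : ℂ, StTrkDQ η f x₀ s hmax R Hs B (j + 1) u :=
  succ_of_newton_door' hE hv hK hρ₀ hoff hh0 (fieldVariation_of_lipschitz hK hΛ hh0 hlip) hdisc

/-- Two-point form with `hdisc`. -/
theorem succ_of_newton_door_twoPointU_disc {η : ℝ} {f : ℂ → ℂ} {x₀ s hmax R Hs : ℝ} {B j : ℕ} {v : ℂ}
    (hE : EngineHyps5 2 η f x₀ s hmax R Hs B) (hv : StTrkDQ η f x₀ s hmax R Hs B j v) {K : ℂ} (hK : K ≠ 0)
    {ρ₀ : ℝ} (hρ₀ : 0 < ρ₀) (hoff : ρ₀ / ‖K‖ ≤ |(v - K⁻¹).im|)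
    {ι : Type*} (a : ι → ℂ) (m : ι → ℝ) (hm : ∀ i, 0 ≤ m i)
    (hzeros : ∀ z, dslope (iteratedDeriv j f) v z = 0 → ∃ i, z = a i)
    (hineq : ∀ z : ℂ, ‖z - (v - K⁻¹)‖ = ρ₀ / ‖K‖ →
      ‖deriv (dslope (iteratedDeriv j f) v) z / dslope (iteratedDeriv j f) v z - K‖ ≤ ‖z - v‖ * ∑' i, m i / (‖z - a i‖ * ‖v - a i‖))
    (hSv : Summable fun i => m i / (‖v - a i‖ * ‖v - a i‖))
    {δ : ℝ} (hδ : 0 < δ) (hsep : ∀ i, (1 + ρ₀) / ‖K‖ + δ ≤ ‖v - a i‖)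
    (hend : (1 + ρ₀) * ((1 + ρ₀) / ‖K‖ * ∑' i, m i / ((‖v - a i‖ - (1 + ρ₀) / ‖K‖) * ‖v - a i‖)) < ρ₀ * ‖K‖)
    (hdisc : ∀ z : ℂ, ‖z - (v - K⁻¹)‖ < ρ₀ / ‖K‖ → |z.im| ≤ Hs →
      (max (|z.re - x₀| - R / 2) 0) ^ 2 + ((j : ℝ) + 1) * z.im ^ 2 ≤ ((j : ℝ) + 1) * Hs ^ 2) :
    ∃ u : ℂ, StTrkDQ η f x₀ s hmax R Hs B (j + 1) u := by
  have hKn : 0 < ‖K‖ := norm_pos_iff.mpr hK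
  have hrN : 0 ≤ (1 + ρ₀) / ‖K‖ := by positivity
  have hsep' : ∀ i, 0 < m i → (1 + ρ₀) / ‖K‖ < ‖v - a i‖ := fun i _ => by linarith [hsep i]
  have hh0 : ∀ z : ℂ, ‖z - (v - K⁻¹)‖ ≤ ρ₀ / ‖K‖ → dslope (iteratedDeriv j f) v z ≠ 0 := by
    intro z hz hz0
    obtain ⟨i, rfl⟩ := hzeros z hz0
    have h1 : ‖a i - v‖ ≤ (1 + ρ₀) / ‖K‖ := norm_sub_le_of_newtonDisc hK hz
    have h2 := hsep i
    rw [norm_sub_rev] at h2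
    linarith
  have hS := summable_majorant_of_uniform_sep a m hm hrN hδ (fun i _ => hsep i) hSv
  refine succ_of_newton_door_lip_disc hE hv hK hρ₀ hend hoff hh0 ?_ hdisc
  intro z hz
  exact le_trans (hineq z hz) (tsum_twoPoint_le a m hm (norm_sub_le_of_newtonDisc hK (le_of_eq hz)) hsep' hS)

/-- Genus-one primitive-data form with `hdisc` (body = `RhW08.NewtonDoorGenusOne.succ_of_newton_door_genusOne`, last line changed). -/
theorem succ_of_newton_door_genusOne_disc {η : ℝ} {f : ℂ → ℂ} {x₀ s hmax R Hs : ℝ} {B j : ℕ} {v : ℂ}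
    (hE : EngineHyps5 2 η f x₀ s hmax R Hs B) (hv : StTrkDQ η f x₀ s hmax R Hs B j v)
    {C ρ : ℝ} (hFd : Differentiable ℂ (iteratedDeriv j f))
    (hgrowth : ∀ z, ‖iteratedDeriv j f z‖ ≤ C * Real.exp (‖z‖ ^ ρ)) (hρ : ρ < 2)
    (hFv : iteratedDeriv j f v = 0) (hsimple : analyticOrderAt (iteratedDeriv j f) v = 1)
    {K : ℂ} (hKdef : K = deriv (dslope (iteratedDeriv j f) v) v / dslope (iteratedDeriv j f) v v)
    (hK : K ≠ 0) {ρ₀ : ℝ} (hρ₀ : 0 < ρ₀) (hoff : ρ₀ / ‖K‖ ≤ |(v - K⁻¹).im|)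
    {δ : ℝ} (hδ : 0 < δ)
    (hsepZ : ∀ c, dslope (iteratedDeriv j f) v c = 0 → (1 + ρ₀) / ‖K‖ + δ ≤ ‖v - c‖)
    (hendZ : (1 + ρ₀) * ((1 + ρ₀) / ‖K‖ * ∑' c : ℂ, (analyticOrderNatAt (dslope (iteratedDeriv j f) v) c : ℝ) /
        ((‖v - c‖ - (1 + ρ₀) / ‖K‖) * ‖v - c‖)) < ρ₀ * ‖K‖)
    (hdisc : ∀ z : ℂ, ‖z - (v - K⁻¹)‖ < ρ₀ / ‖K‖ → |z.im| ≤ Hs →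
      (max (|z.re - x₀| - R / 2) 0) ^ 2 + ((j : ℝ) + 1) * z.im ^ 2 ≤ ((j : ℝ) + 1) * Hs ^ 2) :
    ∃ u : ℂ, StTrkDQ η f x₀ s hmax R Hs B (j + 1) u := by
  obtain ⟨ι, a, m, hm, haF, hm1, hcard, hfiber, hzeros, hEnd, htwo⟩ :=
    GenusOneLogDerivC3g41.twoPoint_bound_dslope hFd hgrowth hρ hFv hsimple
  have hv0 : dslope (iteratedDeriv j f) v v ≠ 0 := by
    rw [dslope_same]
    exact Literature.Barriers.RiemannHypothesis.deriv_ne_zero_of_analyticOrderAt_eq_one (hFd.analyticAt v) hsimple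
  have ha0 : ∀ i, dslope (iteratedDeriv j f) v (a i) = 0 := by
    intro i
    obtain ⟨hz, hne⟩ := haF i
    rw [dslope_of_ne _ hne, slope_def_field, hz, hFv, sub_zero, zero_div]
  have hsep : ∀ i, (1 + ρ₀) / ‖K‖ + δ ≤ ‖v - a i‖ := fun i ↦ hsepZ (a i) (ha0 i)
  have hKn : 0 < ‖K‖ := norm_pos_iff.2 hK
  have hcirc : ∀ z : ℂ, ‖z - (v - K⁻¹)‖ = ρ₀ / ‖K‖ → dslope (iteratedDeriv j f) v z ≠ 0 := by
    intro z hz hz0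
    have h1 : (1 + ρ₀) / ‖K‖ + δ ≤ ‖v - z‖ := hsepZ z hz0
    have h2 : ‖v - z‖ ≤ ρ₀ / ‖K‖ + 1 / ‖K‖ := by
      calc ‖v - z‖ = ‖(v - K⁻¹ - z) + K⁻¹‖ := by congr 1; ring
        _ ≤ ‖v - K⁻¹ - z‖ + ‖K⁻¹‖ := norm_add_le _ _
        _ = ρ₀ / ‖K‖ + 1 / ‖K‖ := by rw [norm_sub_rev, hz, norm_inv, one_div]
    have h3 : ρ₀ / ‖K‖ + 1 / ‖K‖ = (1 + ρ₀) / ‖K‖ := by rw [add_div, add_comm]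
    linarith
  have hzeros' : ∀ z, dslope (iteratedDeriv j f) v z = 0 → ∃ i, z = a i :=
    fun z hz ↦ (hzeros z hz).imp fun i hi ↦ hi.1
  have hineq : ∀ z : ℂ, ‖z - (v - K⁻¹)‖ = ρ₀ / ‖K‖ →
      ‖deriv (dslope (iteratedDeriv j f) v) z / dslope (iteratedDeriv j f) v z - K‖ ≤
        ‖z - v‖ * ∑' i, m i / (‖z - a i‖ * ‖v - a i‖) := by
    intro z hz
    rw [hKdef]
    exact (htwo z v (hcirc z hz) hv0).2
  have hSv : Summable fun i ↦ m i / (‖v - a i‖ * ‖v - a i‖) := (htwo v v hv0 hv0).1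
  have hs1 : Summable fun i ↦ m i / ((‖v - a i‖ - (1 + ρ₀) / ‖K‖) * ‖v - a i‖) :=
    hEnd ((1 + ρ₀) / ‖K‖) (by positivity) (fun i ↦ by linarith [hsep i])
  have hs2 : Summable fun i ↦ m i * (1 / ((‖v - a i‖ - (1 + ρ₀) / ‖K‖) * ‖v - a i‖)) :=
    hs1.congr fun i ↦ by ring
  have h3 := (hfiber (fun c ↦ 1 / ((‖v - c‖ - (1 + ρ₀) / ‖K‖) * ‖v - c‖)) hs2).tsum_eq
  have hEq : ∑' i, m i / ((‖v - a i‖ - (1 + ρ₀) / ‖K‖) * ‖v - a i‖) =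
      ∑' c : ℂ, (analyticOrderNatAt (dslope (iteratedDeriv j f) v) c : ℝ) /
        ((‖v - c‖ - (1 + ρ₀) / ‖K‖) * ‖v - c‖) := by
    rw [show (fun i ↦ m i / ((‖v - a i‖ - (1 + ρ₀) / ‖K‖) * ‖v - a i‖)) =
        fun i ↦ m i * (1 / ((‖v - a i‖ - (1 + ρ₀) / ‖K‖) * ‖v - a i‖)) from funext fun i ↦ by ring, ← h3]
    exact tsum_congr fun c ↦ by ring
  have hend : (1 + ρ₀) * ((1 + ρ₀) / ‖K‖ *
      ∑' i, m i / ((‖v - a i‖ - (1 + ρ₀) / ‖K‖) * ‖v - a i‖)) < ρ₀ * ‖K‖ := by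
    rw [hEq]
    exact hendZ
  exact succ_of_newton_door_twoPointU_disc hE hv hK hρ₀ hoff a m hm hzeros' hineq hSv hδ hsep hend hdisc

/-- NEWTON NUMBERS♯ with data `(K, ρ₀, δ)`: N1 `K ≠ 0`, N3 off-axis, N4 separation + END number — and, replacing BOTH the regime clause
`1 < ‖K‖·Im v` and the scalar slack N5, the JENSEN-DISC CLAUSE `‖(v − K⁻¹) − Re v‖ + ρ₀/‖K‖ ≤ Im v` (the closed Newton disc inside `v`'s own
closed Jensen disc).  FRAME-FREE: no `x₀, R, Hs`. By `newtonChild_mem_disc_iff` the centre condition is `Im K_ext ≤ 0`; the clause is its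
version with margin `ρ₀/‖K‖`. -/
def NewtonNumbersSharpWith (f : ℂ → ℂ) (j : ℕ) (v K : ℂ) (ρ₀ δ : ℝ) : Prop :=
  K ≠ 0 ∧ 0 < ρ₀ ∧ ρ₀ / ‖K‖ ≤ |(v - K⁻¹).im| ∧ 0 < δ ∧
    (∀ c : ℂ, dslope (iteratedDeriv j f) v c = 0 → (1 + ρ₀) / ‖K‖ + δ ≤ ‖v - c‖) ∧
    (1 + ρ₀) * ((1 + ρ₀) / ‖K‖ * ∑' c : ℂ, (analyticOrderNatAt (dslope (iteratedDeriv j f) v) c : ℝ) /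
        ((‖v - c‖ - (1 + ρ₀) / ‖K‖) * ‖v - c‖)) < ρ₀ * ‖K‖ ∧
    ‖(v - K⁻¹) - (v.re : ℂ)‖ + ρ₀ / ‖K‖ ≤ v.im

/-- ★ SOCKET «Newton♯» at the canonical field value. -/
def NewtonNumbersSharp (f : ℂ → ℂ) (j : ℕ) (v : ℂ) : Prop :=
  ∃ ρ₀ δ : ℝ, NewtonNumbersSharpWith f j v (newtonK f j v) ρ₀ δ

/-- The Jensen-disc clause gives the WHOLE-DISC band clause by Jensen nesting (`band_of_hang`): every point of the open Newton disc is a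
`NestedStep` child of the band state `v`. -/
theorem hdisc_of_jensenDisc {η : ℝ} {f : ℂ → ℂ} {x₀ s hmax R Hs : ℝ} {B j : ℕ} {v K : ℂ} {ρ₀ : ℝ}
    (hv : StTrkDQ η f x₀ s hmax R Hs B j v) (hJ : ‖(v - K⁻¹) - (v.re : ℂ)‖ + ρ₀ / ‖K‖ ≤ v.im) :
    ∀ z : ℂ, ‖z - (v - K⁻¹)‖ < ρ₀ / ‖K‖ → |z.im| ≤ Hs →
      (max (|z.re - x₀| - R / 2) 0) ^ 2 + ((j : ℝ) + 1) * z.im ^ 2 ≤ ((j : ℝ) + 1) * Hs ^ 2 := by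
  intro z hz _
  have hv' : StColQ' η f x₀ s hmax R Hs B j v := hv
  apply band_of_hang hv'
  -- `NestedStep v z`: `(z.re − v.re)² + z.im² ≤ v.im²`
  have h1 : ‖z - (v.re : ℂ)‖ ≤ v.im := by
    calc ‖z - (v.re : ℂ)‖ = ‖(z - (v - K⁻¹)) + ((v - K⁻¹) - (v.re : ℂ))‖ := by congr 1; ring
      _ ≤ ‖z - (v - K⁻¹)‖ + ‖(v - K⁻¹) - (v.re : ℂ)‖ := norm_add_le _ _
      _ ≤ v.im := by linarith
  have hy : 0 ≤ v.im := le_trans (norm_nonneg _) h1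
  have h2 : ‖z - (v.re : ℂ)‖ ^ 2 ≤ v.im ^ 2 := pow_le_pow_left₀ (norm_nonneg _) h1 2
  have h3 : ‖z - (v.re : ℂ)‖ ^ 2 = (z.re - v.re) ^ 2 + z.im ^ 2 := by
    rw [← Complex.normSq_eq_norm_sq, Complex.normSq_apply]
    simp [Complex.sub_re, Complex.sub_im]
    ring
  unfold NestedStep
  linarith [h2, h3]

/-- ★★ DOOR N♯: a legal frame, a band state `v`, and Newton numbers♯ ⇒ the successor state (multiple zero: `succ_of_multiple`; simple zero:
the genus-one engine with the whole-disc clause from `hdisc_of_jensenDisc`).  No `1 < ‖K‖·Im v`, no scalar slack. -/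
theorem succ_of_newtonNumbersSharp {η : ℝ} {f : ℂ → ℂ} {x₀ s hmax R Hs : ℝ} {B j : ℕ} {v : ℂ}
    (hE : EngineHyps5 2 η f x₀ s hmax R Hs B) (hv : StTrkDQ η f x₀ s hmax R Hs B j v) (hN : NewtonNumbersSharp f j v) :
    ∃ u : ℂ, StTrkDQ η f x₀ s hmax R Hs B (j + 1) u := by
  by_cases hz : iteratedDeriv (j + 1) f v = 0
  · exact succ_of_multiple hE hv hz
  obtain ⟨ρ₀, δ, hK, hρ₀, hoff, hδ, hsepZ, hendZ, hJ⟩ := hN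
  have hf : Summit.RiemannHypothesis.RiemannHypothesis.Theorems.Splittings.JensenWindow.RealEntireLt2 f :=
    realEntireLt2_of_hyps hE
  obtain ⟨ρ, C, hρ0, hρ, hgr⟩ := hf.growth
  obtain ⟨ρ', C', -, hρ', hgr'⟩ := Literature.Analysis.Complex.exists_growth_iteratedDeriv hf.diff hρ0 hρ hgr j
  have hFd : Differentiable ℂ (iteratedDeriv j f) := differentiable_iteratedDeriv_of_entire hE.1 j
  have hv' : StColQ' η f x₀ s hmax R Hs B j v := hv
  obtain ⟨-, hFv, -⟩ := hv'
  have hderiv : deriv (iteratedDeriv j f) v ≠ 0 := by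
    rw [← iteratedDeriv_succ]; exact hz
  have hsimple : analyticOrderAt (iteratedDeriv j f) v = 1 :=
    (hFd.analyticAt v).analyticOrderAt_eq_one_of_zero_deriv_ne_zero hFv hderiv
  exact succ_of_newton_door_genusOne_disc hE hv hFd hgr' hρ' hFv hsimple rfl hK hρ₀ hoff hδ hsepZ hendZ
    (hdisc_of_jensenDisc hv hJ)

/-! ## §6 REGIME OBSERVABLES and the typed regime boundaries (director CA440: «which regime boundary does the idea control»)

Two dimensionless numbers of the tracked state `v` (with `y = Im v`, `K = newtonK f j v`):
* the COVER INDEX `ι := y·Im K + ½` — by `newtonChild_mem_disc_iff`, `ι ≤ 0` iff the Newton centre `v − K⁻¹` lies in `v`'s closed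
  Jensen disc; by `pairField_im_pos_iff` only a COVERING pair contributes positively to it;
* the FIELD STRENGTH `κ := ‖K‖·y` — door N's regime clause is `1 < κ`.
Boundaries proved below: (B1) the Jensen clause of N♯ with margin `ρ₀` is EXACTLY `ρ₀ ≤ κ ∧ 2ι ≤ ρ₀² − 2ρ₀κ`; (B2) weak field forces
cover: `κ < ½ → 0 < ι` (so an un-covered state always has `κ ≥ ½`: the weak-field regime of U/L is a sub-regime of COVERED). -/

/-- ι, the cover index. -/
noncomputable def coverIndex (f : ℂ → ℂ) (j : ℕ) (v : ℂ) : ℝ := v.im * (newtonK f j v).im + 1 / 2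

/-- κ, the field strength in units of `1/Im v`. -/
noncomputable def fieldStrength (f : ℂ → ℂ) (j : ℕ) (v : ℂ) : ℝ := ‖newtonK f j v‖ * v.im

/-- Exact size of the Newton displacement seen from the Jensen-disc centre: `‖(v − K⁻¹) − Re v‖²·‖K‖² = y²‖K‖² + (1 + 2y·Im K)`. -/
theorem normSq_newtonCentre_mul (v : ℂ) {K : ℂ} (hK : K ≠ 0) :
    ‖(v - K⁻¹) - (v.re : ℂ)‖ ^ 2 * ‖K‖ ^ 2 = v.im ^ 2 * ‖K‖ ^ 2 + (1 + 2 * v.im * K.im) := by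
  have hn : 0 < Complex.normSq K := Complex.normSq_pos.mpr hK
  have hexpr : (v - K⁻¹) - (v.re : ℂ) = (v.im : ℂ) * I - K⁻¹ := Complex.ext (by simp) (by simp)
  rw [hexpr]
  have hre : ((v.im : ℂ) * I - K⁻¹).re = -(K.re / Complex.normSq K) := by
    simp [Complex.sub_re, Complex.mul_re, Complex.inv_re]
  have him : ((v.im : ℂ) * I - K⁻¹).im = v.im + K.im / Complex.normSq K := by
    simp [Complex.sub_im, Complex.mul_im, Complex.inv_im]
    ring
  have key : Complex.normSq ((v.im : ℂ) * I - K⁻¹) * Complex.normSq K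
      = v.im ^ 2 * Complex.normSq K + (1 + 2 * v.im * K.im) := by
    have hnK : Complex.normSq K = K.re * K.re + K.im * K.im := Complex.normSq_apply K
    rw [Complex.normSq_apply ((v.im : ℂ) * I - K⁻¹), hre, him]
    field_simp
    rw [hnK]; ring
  rw [← Complex.normSq_eq_norm_sq, ← Complex.normSq_eq_norm_sq]
  exact key

/-- (B1) THE N♯ ⁄ GRAZING BOUNDARY, exactly: the Jensen clause of `NewtonNumbersSharpWith` with margin `ρ₀/‖K‖` holds iff
`ρ₀ ≤ κ` and `2ι ≤ ρ₀² − 2ρ₀κ` (`ι = y·Im K + ½`, `κ = ‖K‖·y`). -/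
theorem jensenClause_iff {v K : ℂ} (hK : K ≠ 0) (ρ₀ : ℝ) :
    ‖(v - K⁻¹) - (v.re : ℂ)‖ + ρ₀ / ‖K‖ ≤ v.im ↔
      ρ₀ ≤ ‖K‖ * v.im ∧ 1 + 2 * v.im * K.im ≤ ρ₀ ^ 2 - 2 * ρ₀ * (‖K‖ * v.im) := by
  have hnK : 0 < ‖K‖ := norm_pos_iff.mpr hK
  have key := normSq_newtonCentre_mul v hK
  set A := ‖(v - K⁻¹) - (v.re : ℂ)‖ with hA
  have hA0 : 0 ≤ A := norm_nonneg _
  constructor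
  · intro h
    have h1 : ρ₀ ≤ ‖K‖ * v.im := by
      have : ρ₀ / ‖K‖ ≤ v.im := by linarith
      rwa [div_le_iff₀ hnK, mul_comm] at this
    refine ⟨h1, ?_⟩
    have h2 : A * ‖K‖ ≤ ‖K‖ * v.im - ρ₀ := by
      have : A ≤ v.im - ρ₀ / ‖K‖ := by linarith
      have := mul_le_mul_of_nonneg_right this hnK.le
      rwa [sub_mul, div_mul_cancel₀ _ hnK.ne', mul_comm v.im] at this
    have h3 : (A * ‖K‖) ^ 2 ≤ (‖K‖ * v.im - ρ₀) ^ 2 :=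
      pow_le_pow_left₀ (mul_nonneg hA0 hnK.le) h2 2
    nlinarith [key, h3]
  · rintro ⟨h1, h2⟩
    have h3 : (A * ‖K‖) ^ 2 ≤ (‖K‖ * v.im - ρ₀) ^ 2 := by nlinarith [key]
    have h4 : A * ‖K‖ ≤ ‖K‖ * v.im - ρ₀ := by
      have hb : 0 ≤ ‖K‖ * v.im - ρ₀ := by linarith
      exact (pow_le_pow_iff_left₀ (mul_nonneg hA0 hnK.le) hb two_ne_zero).mp h3
    have h5 : ρ₀ / ‖K‖ ≤ v.im - A := by
      rw [div_le_iff₀ hnK]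
      nlinarith
    linarith

/-- (B1′) the same boundary in the observables `ι = coverIndex`, `κ = fieldStrength`, for `K = newtonK f j v`. -/
theorem jensenClause_iff_coverIndex {f : ℂ → ℂ} {j : ℕ} {v : ℂ} (hK : newtonK f j v ≠ 0) (ρ₀ : ℝ) :
    ‖(v - (newtonK f j v)⁻¹) - (v.re : ℂ)‖ + ρ₀ / ‖newtonK f j v‖ ≤ v.im ↔
      ρ₀ ≤ fieldStrength f j v ∧ 2 * coverIndex f j v ≤ ρ₀ ^ 2 - 2 * ρ₀ * fieldStrength f j v := by
  rw [jensenClause_iff hK ρ₀]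
  unfold fieldStrength coverIndex
  constructor <;> rintro ⟨h1, h2⟩ <;> exact ⟨h1, by linarith⟩

/-- (B2) WEAK FIELD FORCES COVER: `κ < ½ → 0 < ι` (`|Im K| ≤ ‖K‖`).  Contrapositive: an un-covered state (`ι ≤ 0`) has `κ ≥ ½`. -/
theorem coverIndex_pos_of_weak {f : ℂ → ℂ} {j : ℕ} {v : ℂ} (hv : 0 < v.im) (hκ : fieldStrength f j v < 1 / 2) :
    0 < coverIndex f j v := by
  unfold fieldStrength at hκ
  unfold coverIndex
  have h1 : |(newtonK f j v).im| ≤ ‖newtonK f j v‖ := Complex.abs_im_le_norm _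
  have h2 : -(‖newtonK f j v‖ * v.im) ≤ v.im * (newtonK f j v).im := by
    have := neg_abs_le (newtonK f j v).im
    nlinarith
  linarith

theorem half_le_fieldStrength_of_uncovered {f : ℂ → ℂ} {j : ℕ} {v : ℂ} (hv : 0 < v.im) (hι : coverIndex f j v ≤ 0) :
    1 / 2 ≤ fieldStrength f j v := by
  by_contra h
  push Not at h
  exact absurd hι (not_le.mpr (coverIndex_pos_of_weak hv h))

/-- (B3) door N♯'s AVAILABILITY REGION in the coordinates `(ι, κ)` — `ρ₀ ≤ κ`, `2ι ≤ ρ₀² − 2ρ₀κ` (Jensen margin, (B1)),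
`ρ₀κ ≤ κ² + ι − ½` (off-axis clause N3: the child's height is `y(κ² + ι − ½)/κ²`) — plus the two zero-configuration clauses
(separation, END number) verbatim.  PROVED repackaging: these five give `NewtonNumbersSharp`, hence a successor. -/
theorem newtonNumbersSharp_of_coordinates {f : ℂ → ℂ} {j : ℕ} {v : ℂ} (hv : 0 < v.im) (hK0 : newtonK f j v ≠ 0)
    {ρ₀ δ : ℝ} (hρ₀ : 0 < ρ₀) (hδ : 0 < δ)
    (hρκ : ρ₀ ≤ fieldStrength f j v)
    (hmargin : 2 * coverIndex f j v ≤ ρ₀ ^ 2 - 2 * ρ₀ * fieldStrength f j v)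
    (hoff : ρ₀ * fieldStrength f j v ≤ fieldStrength f j v ^ 2 + coverIndex f j v - 1 / 2)
    (hsep : ∀ c, dslope (iteratedDeriv j f) v c = 0 → (1 + ρ₀) / ‖newtonK f j v‖ + δ ≤ ‖v - c‖)
    (hend : (1 + ρ₀) * ((1 + ρ₀) / ‖newtonK f j v‖ *
        ∑' c, (analyticOrderNatAt (dslope (iteratedDeriv j f) v) c : ℝ) / ((‖v - c‖ - (1 + ρ₀) / ‖newtonK f j v‖) * ‖v - c‖))
        < ρ₀ * ‖newtonK f j v‖) :
    NewtonNumbersSharp f j v := by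
  have hnK : 0 < ‖newtonK f j v‖ := norm_pos_iff.mpr hK0
  refine ⟨ρ₀, δ, hK0, hρ₀, ?_, hδ, hsep, hend, (jensenClause_iff_coverIndex hK0 ρ₀).mpr ⟨hρκ, hmargin⟩⟩
  have him : (v - (newtonK f j v)⁻¹).im = v.im + (newtonK f j v).im / ‖newtonK f j v‖ ^ 2 := by
    rw [Complex.sub_im, Complex.inv_im, Complex.normSq_eq_norm_sq]; ring
  unfold fieldStrength coverIndex at hoff
  have hKy : 0 < ‖newtonK f j v‖ * v.im := mul_pos hnK hv
  have h2 : ρ₀ ≤ ‖newtonK f j v‖ * v.im + (newtonK f j v).im / ‖newtonK f j v‖ := by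
    have h3 : ρ₀ * (‖newtonK f j v‖ * v.im)
        ≤ (‖newtonK f j v‖ * v.im + (newtonK f j v).im / ‖newtonK f j v‖) * (‖newtonK f j v‖ * v.im) := by
      have : (‖newtonK f j v‖ * v.im + (newtonK f j v).im / ‖newtonK f j v‖) * (‖newtonK f j v‖ * v.im)
          = (‖newtonK f j v‖ * v.im) ^ 2 + v.im * (newtonK f j v).im := by
        field_simp
      rw [this]; linarith
    exact le_of_mul_le_mul_right h3 hKy
  have h1 : ρ₀ / ‖newtonK f j v‖ ≤ v.im + (newtonK f j v).im / ‖newtonK f j v‖ ^ 2 := by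
    rw [div_le_iff₀ hnK]
    have : (v.im + (newtonK f j v).im / ‖newtonK f j v‖ ^ 2) * ‖newtonK f j v‖
        = ‖newtonK f j v‖ * v.im + (newtonK f j v).im / ‖newtonK f j v‖ := by
      field_simp
    rw [this]; exact h2
  rw [him]
  exact h1.trans (le_abs_self _)

/-- (B4) the CHILD'S HEIGHT in coordinates: `Im(v − K⁻¹) = y·(κ² + ι − ½)/κ²` — it vanishes on the LANDING CURVE `ι = ½ − κ²`
(door L's territory) and equals `−y` at the ISOLATED-PAIR corner `(κ, ι) = (½, 0)` (no external field: the child is the mirror). -/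
theorem newtonChild_im {f : ℂ → ℂ} {j : ℕ} {v : ℂ} (hv : 0 < v.im) (hK0 : newtonK f j v ≠ 0) :
    (v - (newtonK f j v)⁻¹).im * fieldStrength f j v ^ 2
      = v.im * (fieldStrength f j v ^ 2 + coverIndex f j v - 1 / 2) := by
  have hnK : 0 < ‖newtonK f j v‖ := norm_pos_iff.mpr hK0
  unfold fieldStrength coverIndex
  rw [Complex.sub_im, Complex.inv_im, Complex.normSq_eq_norm_sq]
  field_simp
  ring

/-! ## §7 DOOR N♭ — the band slack CHARGED AT THE CHILD with its SIGNED height (the cheapest cash-out of the sign reading)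

Door N's scalar slack N5 charges the height at `Im v + (1+ρ₀)/‖K‖` — the sign of the vertical displacement `Im K/‖K‖²` is thrown
away.  N♭ keeps N's engine and N's frame but charges the band inequality at the Newton disc's worst corner:
`(max (|Re(v − K⁻¹) − x₀| + ρ₀/‖K‖ − R/2) 0)² + (j+1)·(|Im(v − K⁻¹)| + ρ₀/‖K‖)² ≤ (j+1)·Hs²`.
For an un-covered state (`ι ≤ 0`) the child is LOWER than `v` by `y(½ − ι)/κ²` ((B4)), so at the strip top (C6's R0 cells, `Im v = Hs`,
where N5 is infeasible for every ρ₀ and N♯'s window is `ρ₀ ≤ |ι|/κ ≈ 0.05–0.11`, instr-1 PRICE-lens1-v1) N♭'s window is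
`h₀ ≲ ρ₀ ≤ (½ − ι)/κ` (≈ 0.2 on those rows) — prediction K-A♭ below. -/

/-- FRAME socket for N♭: N♯'s first six clauses verbatim, the seventh = band slack at the child's worst corner. -/
def NewtonNumbersChildWith (f : ℂ → ℂ) (x₀ R Hs : ℝ) (j : ℕ) (v K : ℂ) (ρ₀ δ : ℝ) : Prop :=
  K ≠ 0 ∧ 0 < ρ₀ ∧ ρ₀ / ‖K‖ ≤ |(v - K⁻¹).im| ∧ 0 < δ ∧
  (∀ c : ℂ, dslope (iteratedDeriv j f) v c = 0 → (1 + ρ₀) / ‖K‖ + δ ≤ ‖v - c‖) ∧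
  (1 + ρ₀) * ((1 + ρ₀) / ‖K‖ *
      ∑' c : ℂ, (analyticOrderNatAt (dslope (iteratedDeriv j f) v) c : ℝ) / ((‖v - c‖ - (1 + ρ₀) / ‖K‖) * ‖v - c‖))
    < ρ₀ * ‖K‖ ∧
  (max (|(v - K⁻¹).re - x₀| + ρ₀ / ‖K‖ - R / 2) 0) ^ 2 + ((j : ℝ) + 1) * (|(v - K⁻¹).im| + ρ₀ / ‖K‖) ^ 2
    ≤ ((j : ℝ) + 1) * Hs ^ 2

/-- DOOR N♭'s numbers at `(j, v)`: some `(ρ₀, δ)` with `K = newtonK f j v`. -/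
def NewtonNumbersChild (f : ℂ → ℂ) (x₀ R Hs : ℝ) (j : ℕ) (v : ℂ) : Prop :=
  ∃ ρ₀ δ : ℝ, NewtonNumbersChildWith f x₀ R Hs j v (newtonK f j v) ρ₀ δ

/-- The child-charged corner slack gives the whole-disc band clause (monotonicity of the band inequality in `|Re z − x₀|`, `|Im z|`). -/
theorem hdisc_of_childSlack {x₀ R Hs : ℝ} {j : ℕ} {c₀ : ℂ} {r : ℝ}
    (hS : (max (|c₀.re - x₀| + r - R / 2) 0) ^ 2 + ((j : ℝ) + 1) * (|c₀.im| + r) ^ 2 ≤ ((j : ℝ) + 1) * Hs ^ 2) :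
    ∀ z : ℂ, ‖z - c₀‖ < r → |z.im| ≤ Hs →
      (max (|z.re - x₀| - R / 2) 0) ^ 2 + ((j : ℝ) + 1) * z.im ^ 2 ≤ ((j : ℝ) + 1) * Hs ^ 2 := by
  intro z hz _
  have hre : |(z - c₀).re| ≤ ‖z - c₀‖ := Complex.abs_re_le_norm _
  have him : |(z - c₀).im| ≤ ‖z - c₀‖ := Complex.abs_im_le_norm _
  rw [Complex.sub_re] at hre
  rw [Complex.sub_im] at him
  have h1 : |z.re - x₀| ≤ |c₀.re - x₀| + r := by
    have h' : |z.re - c₀.re| ≤ r := by linarith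
    calc |z.re - x₀| = |(z.re - c₀.re) + (c₀.re - x₀)| := by ring_nf
      _ ≤ |z.re - c₀.re| + |c₀.re - x₀| := abs_add_le _ _
      _ ≤ |c₀.re - x₀| + r := by linarith
  have h2 : |z.im| ≤ |c₀.im| + r := by
    calc |z.im| = |(z.im - c₀.im) + c₀.im| := by ring_nf
      _ ≤ |z.im - c₀.im| + |c₀.im| := abs_add_le _ _
      _ ≤ |c₀.im| + r := by linarith
  have hA : max (|z.re - x₀| - R / 2) 0 ≤ max (|c₀.re - x₀| + r - R / 2) 0 :=
    max_le_max (by linarith) le_rfl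
  have hA0 : 0 ≤ max (|z.re - x₀| - R / 2) 0 := le_max_right _ _
  have hA2 : (max (|z.re - x₀| - R / 2) 0) ^ 2 ≤ (max (|c₀.re - x₀| + r - R / 2) 0) ^ 2 := pow_le_pow_left₀ hA0 hA 2
  have hB2 : z.im ^ 2 ≤ (|c₀.im| + r) ^ 2 := by
    calc z.im ^ 2 = |z.im| ^ 2 := (sq_abs _).symm
      _ ≤ (|c₀.im| + r) ^ 2 := pow_le_pow_left₀ (abs_nonneg _) h2 2
  have hj : (0 : ℝ) ≤ (j : ℝ) + 1 := by positivity
  nlinarith [mul_le_mul_of_nonneg_left hB2 hj]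

/-- ★★ DOOR N♭: a legal frame, a band state `v`, and child-charged Newton numbers ⇒ the successor state.  No `1 < ‖K‖·Im v`. -/
theorem succ_of_newtonNumbersChild {η : ℝ} {f : ℂ → ℂ} {x₀ s hmax R Hs : ℝ} {B j : ℕ} {v : ℂ}
    (hE : EngineHyps5 2 η f x₀ s hmax R Hs B) (hv : StTrkDQ η f x₀ s hmax R Hs B j v) (hN : NewtonNumbersChild f x₀ R Hs j v) :
    ∃ u : ℂ, StTrkDQ η f x₀ s hmax R Hs B (j + 1) u := by
  by_cases hz : iteratedDeriv (j + 1) f v = 0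
  · exact succ_of_multiple hE hv hz
  obtain ⟨ρ₀, δ, hK, hρ₀, hoff, hδ, hsepZ, hendZ, hS⟩ := hN
  have hf : Summit.RiemannHypothesis.RiemannHypothesis.Theorems.Splittings.JensenWindow.RealEntireLt2 f :=
    realEntireLt2_of_hyps hE
  obtain ⟨ρ, C, hρ0, hρ, hgr⟩ := hf.growth
  obtain ⟨ρ', C', -, hρ', hgr'⟩ := Literature.Analysis.Complex.exists_growth_iteratedDeriv hf.diff hρ0 hρ hgr j
  have hFd : Differentiable ℂ (iteratedDeriv j f) := differentiable_iteratedDeriv_of_entire hE.1 j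
  have hv' : StColQ' η f x₀ s hmax R Hs B j v := hv
  obtain ⟨-, hFv, -⟩ := hv'
  have hderiv : deriv (iteratedDeriv j f) v ≠ 0 := by
    rw [← iteratedDeriv_succ]; exact hz
  have hsimple : analyticOrderAt (iteratedDeriv j f) v = 1 :=
    (hFd.analyticAt v).analyticOrderAt_eq_one_of_zero_deriv_ne_zero hFv hderiv
  exact succ_of_newton_door_genusOne_disc hE hv hFd hgr' hρ' hFv hsimple rfl hK hρ₀ hoff hδ hsepZ hendZ
    (hdisc_of_childSlack hS)

/-- (B6) N♭'s HEIGHT clause in coordinates for an un-covered-below-the-axis-safe state: when the child is in the upper half-plane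
(`κ² + ι − ½ ≥ 0`), `|Im(v − K⁻¹)| + ρ₀/‖K‖ ≤ Hs` iff `y·(κ² + ι − ½) + ρ₀·y·κ ≤ Hs·κ²` — at the strip top `y = Hs` this is
`ρ₀ ≤ (½ − ι)/κ`, against N♯'s `ρ₀ ≲ |ι|/κ` and N5's `∅`. -/
theorem childHeight_le_iff {f : ℂ → ℂ} {j : ℕ} {v : ℂ} (hv : 0 < v.im) (hK0 : newtonK f j v ≠ 0) {ρ₀ Hs : ℝ}
    (hup : 0 ≤ fieldStrength f j v ^ 2 + coverIndex f j v - 1 / 2) :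
    |(v - (newtonK f j v)⁻¹).im| + ρ₀ / ‖newtonK f j v‖ ≤ Hs ↔
      v.im * (fieldStrength f j v ^ 2 + coverIndex f j v - 1 / 2) + ρ₀ * v.im * fieldStrength f j v
        ≤ Hs * fieldStrength f j v ^ 2 := by
  have hnK : 0 < ‖newtonK f j v‖ := norm_pos_iff.mpr hK0
  have hκ : 0 < fieldStrength f j v := by unfold fieldStrength; positivity
  have hh := newtonChild_im hv hK0   -- Im(child)·κ² = y·(κ²+ι−½)
  have hκ2 : 0 < fieldStrength f j v ^ 2 := by positivity
  have him0 : 0 ≤ (v - (newtonK f j v)⁻¹).im := by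
    by_contra hc
    push Not at hc
    have h1 : (v - (newtonK f j v)⁻¹).im * fieldStrength f j v ^ 2 < 0 := mul_neg_of_neg_of_pos hc hκ2
    rw [hh] at h1
    have h2 : 0 ≤ v.im * (fieldStrength f j v ^ 2 + coverIndex f j v - 1 / 2) := mul_nonneg hv.le hup
    linarith
  rw [abs_of_nonneg him0]
  have hρ : ρ₀ / ‖newtonK f j v‖ * fieldStrength f j v ^ 2 = ρ₀ * v.im * fieldStrength f j v := by
    unfold fieldStrength
    field_simp
  have key : ((v - (newtonK f j v)⁻¹).im + ρ₀ / ‖newtonK f j v‖) * fieldStrength f j v ^ 2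
      = v.im * (fieldStrength f j v ^ 2 + coverIndex f j v - 1 / 2) + ρ₀ * v.im * fieldStrength f j v := by
    rw [add_mul, hh, hρ]
  constructor
  · intro h
    have := mul_le_mul_of_nonneg_right h hκ2.le
    rw [key] at this
    exact this
  · intro h
    rw [← key] at h
    exact le_of_mul_le_mul_right h hκ2

/-! ## §8 (E1) the END number under SEPARATION: far zeros ⇒ the END sum is at most `2·S₂` ⇒ piece F with honest constants

With `g := dslope (f^{(j)}) v` (zeros = the other zeros of `f^{(j)}`, multiplicity `ord`), `r := (1+ρ₀)/‖K‖`: if every zero `c` of `g` has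
`‖v − c‖ ≥ 2r` then `Σ' ord(c)/((‖v−c‖ − r)‖v−c‖) ≤ 2·Σ' ord(c)/‖v−c‖² =: 2S₂`, so END holds as soon as `2(1+ρ₀)²·S₂ < ρ₀‖K‖²`
(in coordinates: `2(1+ρ₀)²·S₂y² < ρ₀κ²`).  Together with (B3): UN-COVERED-with-margin ∧ FAR ∧ LIGHT ⇒ N♯ ⇒ successor — PROVED. -/

theorem analyticOrderNatAt_eq_zero_of_ne {g : ℂ → ℂ} (hg : Differentiable ℂ g) {c : ℂ} (hc : g c ≠ 0) :
    analyticOrderNatAt g c = 0 := by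
  have ha : AnalyticAt ℂ g c := hg.analyticAt c
  unfold analyticOrderNatAt
  rw [ha.analyticOrderAt_eq_zero.mpr hc]
  rfl

/-- (E1) termwise-to-sum: separation `2r` turns the END sum into `≤ 2·S₂`. -/
theorem endSum_le_two_S2 {g : ℂ → ℂ} (hg : Differentiable ℂ g) {v : ℂ} {r : ℝ} (hr : 0 < r)
    (hsep : ∀ c : ℂ, g c = 0 → 2 * r ≤ ‖v - c‖)
    (hS : Summable (fun c : ℂ => (analyticOrderNatAt g c : ℝ) / ‖v - c‖ ^ 2)) :
    ∑' c : ℂ, (analyticOrderNatAt g c : ℝ) / ((‖v - c‖ - r) * ‖v - c‖)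
      ≤ 2 * ∑' c : ℂ, (analyticOrderNatAt g c : ℝ) / ‖v - c‖ ^ 2 := by
  have hterm : ∀ c : ℂ, (analyticOrderNatAt g c : ℝ) / ((‖v - c‖ - r) * ‖v - c‖)
      ≤ 2 * ((analyticOrderNatAt g c : ℝ) / ‖v - c‖ ^ 2) := by
    intro c
    by_cases hc : g c = 0
    · have hd : 2 * r ≤ ‖v - c‖ := hsep c hc
      have hd0 : 0 < ‖v - c‖ := by linarith
      have hdr : ‖v - c‖ / 2 ≤ ‖v - c‖ - r := by linarith
      have hdr0 : 0 < ‖v - c‖ - r := by linarith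
      have hn : (0 : ℝ) ≤ (analyticOrderNatAt g c : ℝ) := by positivity
      rw [div_le_iff₀ (mul_pos hdr0 hd0)]
      have : 2 * ((analyticOrderNatAt g c : ℝ) / ‖v - c‖ ^ 2) * ((‖v - c‖ - r) * ‖v - c‖)
          = (analyticOrderNatAt g c : ℝ) * (2 * (‖v - c‖ - r) / ‖v - c‖) := by
        field_simp
      rw [this]
      have h2 : 1 ≤ 2 * (‖v - c‖ - r) / ‖v - c‖ := by
        rw [le_div_iff₀ hd0]; linarith
      nlinarith
    · rw [analyticOrderNatAt_eq_zero_of_ne hg hc]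
      simp
  have hnn : ∀ c : ℂ, 0 ≤ (analyticOrderNatAt g c : ℝ) / ((‖v - c‖ - r) * ‖v - c‖) := by
    intro c
    by_cases hc : g c = 0
    · have hd : 2 * r ≤ ‖v - c‖ := hsep c hc
      have hdr0 : 0 < ‖v - c‖ - r := by linarith
      have hd0 : 0 < ‖v - c‖ := by linarith
      positivity
    · rw [analyticOrderNatAt_eq_zero_of_ne hg hc]
      simp
  have hS2 : Summable (fun c : ℂ => 2 * ((analyticOrderNatAt g c : ℝ) / ‖v - c‖ ^ 2)) := hS.mul_left 2
  have hS1 : Summable (fun c : ℂ => (analyticOrderNatAt g c : ℝ) / ((‖v - c‖ - r) * ‖v - c‖)) :=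
    Summable.of_nonneg_of_le hnn hterm hS2
  calc ∑' c : ℂ, (analyticOrderNatAt g c : ℝ) / ((‖v - c‖ - r) * ‖v - c‖)
      ≤ ∑' c : ℂ, 2 * ((analyticOrderNatAt g c : ℝ) / ‖v - c‖ ^ 2) := hS1.tsum_le_tsum hterm hS2
    _ = 2 * ∑' c : ℂ, (analyticOrderNatAt g c : ℝ) / ‖v - c‖ ^ 2 := tsum_mul_left

/-- ★ (B3+E1) PIECE F PROVED: an un-covered state with Jensen margin `ρ₀`, off-axis room, every other zero at distance
`≥ 2(1+ρ₀)/‖K‖ + δ`, and LIGHT far field `2(1+ρ₀)²·S₂ < ρ₀‖K‖²` has Newton numbers♯, hence a successor. -/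
theorem newtonNumbersSharp_of_far {f : ℂ → ℂ} (hf : Differentiable ℂ f) {j : ℕ} {v : ℂ} (hv : 0 < v.im)
    (hK0 : newtonK f j v ≠ 0) {ρ₀ δ : ℝ} (hρ₀ : 0 < ρ₀) (hδ : 0 < δ)
    (hρκ : ρ₀ ≤ fieldStrength f j v)
    (hmargin : 2 * coverIndex f j v ≤ ρ₀ ^ 2 - 2 * ρ₀ * fieldStrength f j v)
    (hoff : ρ₀ * fieldStrength f j v ≤ fieldStrength f j v ^ 2 + coverIndex f j v - 1 / 2)
    (hsep2 : ∀ c, dslope (iteratedDeriv j f) v c = 0 → 2 * ((1 + ρ₀) / ‖newtonK f j v‖) + δ ≤ ‖v - c‖)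
    (hS : Summable (fun c : ℂ => (analyticOrderNatAt (dslope (iteratedDeriv j f) v) c : ℝ) / ‖v - c‖ ^ 2))
    (hlight : 2 * (1 + ρ₀) ^ 2 * ∑' c : ℂ, (analyticOrderNatAt (dslope (iteratedDeriv j f) v) c : ℝ) / ‖v - c‖ ^ 2
        < ρ₀ * ‖newtonK f j v‖ ^ 2) :
    NewtonNumbersSharp f j v := by
  have hnK : 0 < ‖newtonK f j v‖ := norm_pos_iff.mpr hK0
  have hG : Differentiable ℂ (iteratedDeriv j f) := by
    have := hf.contDiff (n := ⊤)
    exact (this.differentiable_iteratedDeriv j (WithTop.coe_lt_top _))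
  have hg : Differentiable ℂ (dslope (iteratedDeriv j f) v) :=
    Literature.NumberTheory.LFunctions.BurnolVectors.differentiable_dslope hG v
  have hr : 0 < (1 + ρ₀) / ‖newtonK f j v‖ := by positivity
  have hsep : ∀ c, dslope (iteratedDeriv j f) v c = 0 → (1 + ρ₀) / ‖newtonK f j v‖ + δ ≤ ‖v - c‖ := by
    intro c hc
    have := hsep2 c hc
    linarith
  have hsep' : ∀ c, dslope (iteratedDeriv j f) v c = 0 → 2 * ((1 + ρ₀) / ‖newtonK f j v‖) ≤ ‖v - c‖ := by
    intro c hc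
    have := hsep2 c hc
    linarith
  have hE1 := endSum_le_two_S2 hg hr hsep' hS
  refine newtonNumbersSharp_of_coordinates hv hK0 hρ₀ hδ hρκ hmargin hoff hsep ?_
  set T := ∑' c : ℂ, (analyticOrderNatAt (dslope (iteratedDeriv j f) v) c : ℝ) /
      ((‖v - c‖ - (1 + ρ₀) / ‖newtonK f j v‖) * ‖v - c‖) with hT
  set S₂ := ∑' c : ℂ, (analyticOrderNatAt (dslope (iteratedDeriv j f) v) c : ℝ) / ‖v - c‖ ^ 2 with hS₂
  have h1 : (1 + ρ₀) * ((1 + ρ₀) / ‖newtonK f j v‖ * T) ≤ (1 + ρ₀) * ((1 + ρ₀) / ‖newtonK f j v‖ * (2 * S₂)) := by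
    have h1ρ : 0 ≤ 1 + ρ₀ := by linarith
    exact mul_le_mul_of_nonneg_left (mul_le_mul_of_nonneg_left hE1 hr.le) h1ρ
  have h2 : (1 + ρ₀) * ((1 + ρ₀) / ‖newtonK f j v‖ * (2 * S₂)) < ρ₀ * ‖newtonK f j v‖ := by
    rw [show (1 + ρ₀) * ((1 + ρ₀) / ‖newtonK f j v‖ * (2 * S₂)) = (2 * (1 + ρ₀) ^ 2 * S₂) / ‖newtonK f j v‖ by
      field_simp]
    rw [div_lt_iff₀ hnK]
    nlinarith [hlight]
  exact lt_of_le_of_lt h1 h2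

/-! ## §9 PIECE R (ROOF LOCALISATION) modulo ONE typed analytic input — the SIGN IDENTITY (S1)

(S1) says: the zeros of `F = f^{(j)}` other than `v, v̄` can be listed (with multiplicity, conjugation-closed) so that
`2·Im K_ext(v) = Σ_i pairTerm v (a i)`, i.e. `2ι = y·Σ_i pairTerm v (a i)`.  DERIVATION for C1 (no Hadamard constant, no limits):
put `g := F/((z − v)(z − v̄))` — REAL entire of the same growth, `g(v) = F′(v)/(v − v̄) ≠ 0`, `g′/g(v) = K − 1/(v − v̄) = K + i/(2y) = K_ext`,
`g′/g(v̄) = conj(K_ext)` (reality); the genus-one TWO-POINT identity (`…GenusOneLogDerivC3g41.logDeriv_sub_logDeriv_eq_tsum_zeros`, for the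
translate of `g`) between `v` and `v̄` gives `2i·Im K_ext = Σ_c [1/(v−c) − 1/(v̄−c)]`; re-indexing the conjugation-closed list,
`Σ_c Im 1/(v̄ − c) = −Σ_c Im 1/(v − c)`, whence `2·Im K_ext = Σ_c pairTerm v c`.  Below: GIVEN (S1), the cover criterion (R1) and the
quantitative localisation (R3) are PROVED, with the exact constant: `2ι·d₁ ≤ y·#(covering zeros listed)`, i.e. `ι·d₁ ≤ m·y` for `m` covering pairs. -/

/-- The PAIR TERM of the signed potential: `Im[(v − c)⁻¹ + (v − c̄)⁻¹]` (symmetric in `c ↔ c̄`). -/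
noncomputable def pairTerm (v c : ℂ) : ℝ := ((v - c)⁻¹ + (v - conj c)⁻¹).im

theorem pairTerm_conj (v c : ℂ) : pairTerm v (conj c) = pairTerm v c := by
  unfold pairTerm
  rw [Complex.conj_conj, add_comm]

/-- (S1) THE SIGN IDENTITY — typed analytic input (IDEA-NEEDED → C1; derivation in the section docstring). -/
def CoverIndexPairSum (f : ℂ → ℂ) (j : ℕ) (v : ℂ) : Prop :=
  ∃ (I : Type) (a : I → ℂ), (∀ i, iteratedDeriv j f (a i) = 0 ∧ a i ≠ v ∧ a i ≠ conj v) ∧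
    Summable (fun i => pairTerm v (a i)) ∧ 2 * coverIndex f j v = v.im * ∑' i, pairTerm v (a i)

/-- (R1) COVER CRITERION (given S1): a positive cover index forces a COVERING zero pair of `f^{(j)}`. -/
theorem exists_cover_of_coverIndex_pos {f : ℂ → ℂ} {j : ℕ} {v : ℂ} (hS : CoverIndexPairSum f j v) (hv : 0 < v.im)
    (hι : 0 < coverIndex f j v) :
    ∃ c : ℂ, iteratedDeriv j f c = 0 ∧ c ≠ v ∧ c ≠ conj v ∧ (v.re - c.re) ^ 2 + v.im ^ 2 < c.im ^ 2 := by
  obtain ⟨I, a, ha, hsum, hid⟩ := hS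
  by_contra hno
  push Not at hno
  have hle : ∀ i, pairTerm v (a i) ≤ 0 := by
    intro i
    obtain ⟨h0, h1, h2⟩ := ha i
    have hc := hno (a i) h0 h1 h2
    by_contra hp
    push Not at hp
    have := (pairField_im_pos_iff hv h1 h2).mp hp
    linarith
  have h1 : ∑' i, pairTerm v (a i) ≤ 0 := tsum_nonpos hle
  have h2 : v.im * ∑' i, pairTerm v (a i) ≤ 0 := mul_nonpos_of_nonneg_of_nonpos hv.le h1
  linarith

/-- (R2) the pair term of an upper-half-plane zero is at most `1/‖v − c‖` (pure algebra: the `c̄`-part is negative and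
`(Im c − Im v)/‖v − c‖² ≤ 1/‖v − c‖`). -/
theorem pairTerm_le_inv_norm {v c : ℂ} (hv : 0 < v.im) (hc : 0 < c.im) (h1 : c ≠ v) :
    pairTerm v c ≤ 1 / ‖v - c‖ := by
  have hvc : v - c ≠ 0 := sub_ne_zero.mpr (Ne.symm h1)
  have hn1 : 0 < Complex.normSq (v - c) := Complex.normSq_pos.mpr hvc
  have hvc' : v - conj c ≠ 0 := by
    intro h
    have := congrArg Complex.im h
    simp at this
    linarith
  have hn2 : 0 < Complex.normSq (v - conj c) := Complex.normSq_pos.mpr hvc'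
  have hd : 0 < ‖v - c‖ := norm_pos_iff.mpr hvc
  unfold pairTerm
  rw [Complex.add_im, Complex.inv_im, Complex.inv_im]
  have him1 : (v - c).im = v.im - c.im := by simp
  have him2 : (v - conj c).im = v.im + c.im := by simp
  rw [him1, him2]
  have hA : -(v.im + c.im) / Complex.normSq (v - conj c) ≤ 0 :=
    div_nonpos_of_nonpos_of_nonneg (by linarith) hn2.le
  have hB : -(v.im - c.im) / Complex.normSq (v - c) ≤ 1 / ‖v - c‖ := by
    rw [Complex.normSq_eq_norm_sq, div_le_div_iff₀ (by positivity) hd]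
    have habs : |(v - c).im| ≤ ‖v - c‖ := Complex.abs_im_le_norm _
    rw [him1] at habs
    have : -(v.im - c.im) ≤ ‖v - c‖ := by
      have := neg_abs_le (v.im - c.im)
      have := abs_sub_comm v.im c.im
      linarith [le_abs_self (c.im - v.im)]
    nlinarith
  linarith

/-- (R3) ROOF LOCALISATION (given S1's list): if every covering listed zero lies in the finset `S` and each member of `S`
and its conjugate are at distance `≥ d₁` from `v`, then `2ι·d₁ ≤ y·#S` — a positive cover index puts a covering pair within
`#S·y/(2ι)` of `v` (`#S = 2m` for `m` covering pairs listed with both members). -/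
theorem coverIndex_mul_dist_le {f : ℂ → ℂ} {j : ℕ} {v : ℂ} (hv : 0 < v.im) {I : Type} {a : I → ℂ}
    (ha : ∀ i, iteratedDeriv j f (a i) = 0 ∧ a i ≠ v ∧ a i ≠ conj v)
    (hsum : Summable (fun i => pairTerm v (a i))) (hid : 2 * coverIndex f j v = v.im * ∑' i, pairTerm v (a i))
    (S : Finset I) (hcov : ∀ i, (v.re - (a i).re) ^ 2 + v.im ^ 2 < (a i).im ^ 2 → i ∈ S)
    {d₁ : ℝ} (hd₁ : 0 < d₁) (hd : ∀ i ∈ S, d₁ ≤ ‖v - a i‖ ∧ d₁ ≤ ‖v - conj (a i)‖) :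
    2 * coverIndex f j v * d₁ ≤ v.im * S.card := by
  classical
  -- termwise majorant supported on S
  set g : I → ℝ := fun i => if i ∈ S then 1 / d₁ else 0 with hg
  have hPg : ∀ i, pairTerm v (a i) ≤ g i := by
    intro i
    obtain ⟨h0, h1, h2⟩ := ha i
    by_cases hi : i ∈ S
    · simp only [hg, hi, if_true]
      obtain ⟨hda, hdb⟩ := hd i hi
      -- use the upper representative
      rcases lt_trichotomy 0 (a i).im with hpos | hzero | hneg
      · calc pairTerm v (a i) ≤ 1 / ‖v - a i‖ := pairTerm_le_inv_norm hv hpos h1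
          _ ≤ 1 / d₁ := one_div_le_one_div_of_le hd₁ hda
      · -- real zero: pair term ≤ 0
        have hnp : ¬ 0 < pairTerm v (a i) := by
          intro hp
          have := (pairField_im_pos_iff hv h1 h2).mp hp
          rw [← hzero] at this
          nlinarith [sq_nonneg (v.re - (a i).re)]
        push Not at hnp
        exact hnp.trans (by positivity)
      · have hpos' : 0 < (conj (a i)).im := by simp; linarith
        have h1' : conj (a i) ≠ v := by
          intro h; apply h2; rw [← h, Complex.conj_conj]
        calc pairTerm v (a i) = pairTerm v (conj (a i)) := (pairTerm_conj v (a i)).symm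
          _ ≤ 1 / ‖v - conj (a i)‖ := pairTerm_le_inv_norm hv hpos' h1'
          _ ≤ 1 / d₁ := one_div_le_one_div_of_le hd₁ hdb
    · simp only [hg, hi, if_false]
      have hnc : ¬ ((v.re - (a i).re) ^ 2 + v.im ^ 2 < (a i).im ^ 2) := fun h => hi (hcov i h)
      by_contra hp
      push Not at hp
      exact hnc ((pairField_im_pos_iff hv h1 h2).mp hp)
  have hgS : ∀ i ∉ S, g i = 0 := by intro i hi; simp [hg, hi]
  have hgsum : Summable g := summable_of_ne_finset_zero hgS
  have h1 : ∑' i, pairTerm v (a i) ≤ ∑' i, g i := hsum.tsum_le_tsum hPg hgsum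
  have h2 : ∑' i, g i = S.card * (1 / d₁) := by
    rw [tsum_eq_sum (s := S) (fun i hi => hgS i hi)]
    have : ∀ i ∈ S, g i = 1 / d₁ := by intro i hi; simp [hg, hi]
    rw [Finset.sum_congr rfl this, Finset.sum_const, nsmul_eq_mul]
  have h3 : 2 * coverIndex f j v ≤ v.im * (S.card * (1 / d₁)) := by
    rw [hid, ← h2]; exact mul_le_mul_of_nonneg_left h1 hv.le
  have h4 : v.im * (S.card * (1 / d₁)) * d₁ = v.im * S.card := by field_simp
  calc 2 * coverIndex f j v * d₁ ≤ v.im * (S.card * (1 / d₁)) * d₁ := mul_le_mul_of_nonneg_right h3 hd₁.le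
    _ = v.im * S.card := h4

/-! ## §10 (S1) PROVED — the SIGN IDENTITY, hence PIECE R UNCONDITIONAL in the frame

`coverIndexPairSum_of_growth`: for `F = f^{(j)}` real entire of genus-one growth and a simple zero `v` with `Im v > 0`,
`CoverIndexPairSum f j v` holds — the zero list is Hadamard's (`hadamard_genus_one_zeros`) for the translate of the REAL entire
second cofactor `g = dslope (dslope F v) v̄`, the identity is the genus-one two-point formula
(`GenusOneLogDerivC3g41.logDeriv_sub_logDeriv_eq_tsum_zeros`) between `v̄` and `v` (`g′/g(v) = K − 1/(v − v̄) = K + i/(2y)`,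
`g′/g(v̄) = conj` by Schwarz reflection), and `Im[1/(v̄ − c) − 1/(v − c)] = −pairTerm v c` termwise (no re-indexing, no Hadamard
constant, no limits).  Frame corollaries: `coverIndexPairSum_of_frame` (from `EngineHyps5` + a band state + `f^{(j+1)}(v) ≠ 0`),
`exists_cover_of_coverIndex_pos_frame` (ι > 0 ⇒ a COVERING pair of zeros of `f^{(j)}` exists), `exists_cover_of_weak_frame`
(κ < ½ ⇒ covered) and `roof_localisation_frame` (`2ι·d₁ ≤ y·#S`). -/

/-- (L1) the two-point term between `v̄` and `v` has imaginary part `−pairTerm`. -/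
theorem im_twoPoint_term (v c : ℂ) : ((conj v - c)⁻¹ - (v - c)⁻¹).im = - pairTerm v c := by
  have h : (conj v - c)⁻¹ = conj ((v - conj c)⁻¹) := by
    rw [map_inv₀, map_sub, Complex.conj_conj]
  unfold pairTerm
  rw [h, Complex.sub_im, Complex.conj_im, Complex.add_im]
  ring

/-- (L2) a real entire function has conjugate-symmetric derivative. -/
theorem deriv_conj_of_real {g : ℂ → ℂ} (hg : Differentiable ℂ g) (hreal : ∀ z, g (conj z) = conj (g z))
    (z : ℂ) : deriv g (conj z) = conj (deriv g z) := by
  have h1 : HasDerivAt g (deriv g z) z := (hg z).hasDerivAt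
  have h2 := h1.conj_conj
  have hfun : (conj ∘ g ∘ conj : ℂ → ℂ) = g := by
    funext x
    simp only [Function.comp_apply]
    rw [hreal, Complex.conj_conj]
  rw [hfun] at h2
  exact h2.deriv

open Filter Topology in
/-- (L3) logarithmic derivative of `dslope h w` at a point `v ≠ w` where `h w = 0`, `h v ≠ 0`. -/
theorem logDeriv_dslope_of_ne {h : ℂ → ℂ} (hh : Differentiable ℂ h) {v w : ℂ} (hvw : v ≠ w) (hhw : h w = 0)
    (hhv : h v ≠ 0) : deriv (dslope h w) v / dslope h w v = deriv h v / h v - 1 / (v - w) := by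
  have hval : ∀ z, z ≠ w → dslope h w z = h z * (z - w)⁻¹ := by
    intro z hz
    rw [dslope_of_ne _ hz, slope_def_field, hhw, sub_zero, div_eq_mul_inv]
  have hev : dslope h w =ᶠ[𝓝 v] fun z => h z * (z - w)⁻¹ := by
    filter_upwards [isOpen_ne.mem_nhds hvw] with z hz
    exact hval z hz
  have hsub : v - w ≠ 0 := sub_ne_zero.2 hvw
  have hd1 : HasDerivAt h (deriv h v) v := (hh v).hasDerivAt
  have hd2 : HasDerivAt (fun z : ℂ => (z - w)⁻¹) (-(1 : ℂ) / (v - w) ^ 2) v := by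
    have := ((hasDerivAt_id v).sub_const w).fun_inv (by simpa using hsub)
    simpa using this
  have hd : HasDerivAt (fun z => h z * (z - w)⁻¹) (deriv h v * (v - w)⁻¹ + h v * (-(1 : ℂ) / (v - w) ^ 2)) v :=
    hd1.mul hd2
  have hderiv : deriv (dslope h w) v = deriv h v * (v - w)⁻¹ + h v * (-(1 : ℂ) / (v - w) ^ 2) :=
    (hd.congr_of_eventuallyEq hev).deriv
  rw [hderiv, hval v hvw]
  field_simp
  ring

/-- (S1) PROVED: the sign identity for `F = f^{(j)}` real entire of genus-one growth at a simple zero `v` in the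
upper half-plane.  The zero list is Hadamard's for the translate of `g = dslope (dslope F v) v̄`. -/
theorem coverIndexPairSum_of_growth {f : ℂ → ℂ} {j : ℕ} {v : ℂ} {C ρ : ℝ}
    (hF : Differentiable ℂ (iteratedDeriv j f))
    (hgrowth : ∀ z, ‖iteratedDeriv j f z‖ ≤ C * Real.exp (‖z‖ ^ ρ)) (hρ : ρ < 2)
    (hreal : ∀ z, iteratedDeriv j f (conj z) = conj (iteratedDeriv j f z))
    (hv : 0 < v.im) (hFv : iteratedDeriv j f v = 0)
    (hsimple : analyticOrderAt (iteratedDeriv j f) v = 1) :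
    CoverIndexPairSum f j v := by
  set F : ℂ → ℂ := iteratedDeriv j f with hFdef
  set w : ℂ := conj v with hwdef
  have hwv : w ≠ v := by
    intro e
    have := congrArg Complex.im e
    rw [hwdef, Complex.conj_im] at this
    linarith
  have hvw : v ≠ w := fun e => hwv e.symm
  -- first cofactor
  set h : ℂ → ℂ := dslope F v with hhdef
  have hhd : Differentiable ℂ h := Literature.NumberTheory.LFunctions.BurnolVectors.differentiable_dslope hF v
  have hhv : h v ≠ 0 := by
    rw [hhdef, dslope_same]
    exact Literature.Barriers.RiemannHypothesis.deriv_ne_zero_of_analyticOrderAt_eq_one (hF.analyticAt v) hsimple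
  have hval : ∀ z, z ≠ v → h z = F z / (z - v) := by
    intro z hz
    rw [hhdef, dslope_of_ne _ hz, slope_def_field, hFv, sub_zero]
  have hFw : F w = 0 := by
    rw [hwdef, hreal v, hFv, map_zero]
  have hhw : h w = 0 := by rw [hval w hwv, hFw, zero_div]
  -- second cofactor
  set g : ℂ → ℂ := dslope h w with hgdef
  have hgd : Differentiable ℂ g := Literature.NumberTheory.LFunctions.BurnolVectors.differentiable_dslope hhd w
  have hgval : ∀ z, z ≠ w → g z = h z / (z - w) := by
    intro z hz
    rw [hgdef, dslope_of_ne _ hz, slope_def_field, hhw, sub_zero]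
  have hgval2 : ∀ z, z ≠ v → z ≠ w → g z = F z / ((z - v) * (z - w)) := by
    intro z h1 h2
    rw [hgval z h2, hval z h1, div_div]
  have hgv : g v ≠ 0 := by
    rw [hgval v hvw]
    exact div_ne_zero hhv (sub_ne_zero.2 hvw)
  -- reality of g (continuity + density off {v, w})
  have hgreal : ∀ z, g (conj z) = conj (g z) := by
    have hc1 : Continuous fun z => g (conj z) := hgd.continuous.comp Complex.continuous_conj
    have hc2 : Continuous fun z => conj (g z) := Complex.continuous_conj.comp hgd.continuous
    have hfin : ({v, w} : Set ℂ).Finite := (Set.finite_singleton w).insert v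
    have hdense : Dense (Set.univ \ {v, w} : Set ℂ) := dense_univ.sdiff_finite hfin
    have heq : Set.EqOn (fun z => g (conj z)) (fun z => conj (g z)) (Set.univ \ {v, w}) := by
      intro z hz
      simp only [Set.mem_sdiff, Set.mem_univ, true_and, Set.mem_insert_iff, Set.mem_singleton_iff, not_or] at hz
      obtain ⟨hzv, hzw⟩ := hz
      have h1 : conj z ≠ v := by
        intro e; apply hzw; rw [hwdef, ← e, Complex.conj_conj]
      have h2 : conj z ≠ w := by
        intro e; apply hzv
        have := congrArg conj e
        rw [Complex.conj_conj, hwdef, Complex.conj_conj] at this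
        exact this
      show g (conj z) = conj (g z)
      rw [hgval2 (conj z) h1 h2, hgval2 z hzv hzw, hreal z, map_div₀, map_mul, map_sub, map_sub, hwdef,
        Complex.conj_conj]
      ring
    intro z
    exact congrFun (Continuous.ext_on hdense hc1 hc2 heq) z
  have hgw : g w ≠ 0 := by
    intro h0
    apply hgv
    have h1 : conj (g v) = 0 := by rw [← hgreal v, ← hwdef, h0]
    simpa using congrArg conj h1
  -- growth and Hadamard for the translate
  obtain ⟨C₁, hC₁, hg₁⟩ := GenusOneLogDerivC3g41.growth_nonneg_exponent hF hgrowth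
  set σ : ℝ := max ρ 0 with hσ
  have hσ0 : 0 ≤ σ := le_max_right _ _
  have hσ2 : σ < 2 := max_lt hρ (by norm_num)
  have hgh : ∀ z, ‖h z‖ ≤ (C₁ * Real.exp ((‖v‖ + 1) ^ σ)) * Real.exp (‖z‖ ^ σ) :=
    fun z => GenusOneLogDerivC3g41.norm_dslope_le hF hσ0 hg₁ hFv z
  have hgg : ∀ z, ‖g z‖ ≤ ((C₁ * Real.exp ((‖v‖ + 1) ^ σ)) * Real.exp ((‖w‖ + 1) ^ σ)) * Real.exp (‖z‖ ^ σ) :=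
    fun z => GenusOneLogDerivC3g41.norm_dslope_le hhd hσ0 hgh hhw z
  set G : ℂ → ℂ := fun x => g (x + v) with hGdef
  have hGd : Differentiable ℂ G := hgd.comp (differentiable_id.add_const v)
  set σ' : ℝ := (σ + 2) / 2 with hσ'
  have hσσ' : σ < σ' := by rw [hσ']; linarith
  have hσ'2 : σ' < 2 := by rw [hσ']; linarith
  obtain ⟨C₂, hg₂⟩ := GenusOneLogDerivC3g41.growth_translate hσ0 (by positivity) hgg v hσσ'
  have hG0 : G 0 ≠ 0 := by simpa [hGdef] using hgv
  have hGx : G (w - v) ≠ 0 := by simpa [hGdef] using hgw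
  obtain ⟨b, hb, hzero, -, hprod⟩ := hadamard_genus_one_zeros G σ' C₂ hGd hσ'2 hg₂ hG0
  obtain ⟨hsumZ, hidZ⟩ :=
    GenusOneLogDerivC3g41.logDeriv_sub_logDeriv_eq_tsum_zeros hG0 hb hprod hGx hG0 (hGd _) (hGd _)
  have hlogG : ∀ x : ℂ, logDeriv G x = deriv g (x + v) / g (x + v) := by
    intro x
    rw [logDeriv_apply, hGdef]
    simp only [deriv_comp_add_const]
  rw [hlogG, hlogG, sub_add_cancel, zero_add] at hidZ
  set L : ℂ := deriv g v / g v with hL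
  have hLv : L = newtonK f j v - 1 / (v - w) := by
    rw [hL, hgdef, logDeriv_dslope_of_ne hhd hvw hhw hhv]
    rfl
  have hLw : deriv g w / g w = conj L := by
    rw [hL, map_div₀, ← deriv_conj_of_real hgd hgreal v, ← hgreal v]
  rw [hLw] at hidZ
  -- imaginary parts
  have him := congrArg Complex.im hidZ
  rw [Complex.sub_im, Complex.conj_im, Complex.im_tsum hsumZ] at him
  have hterm : ∀ n, (((GenusOneLogDerivC3g41.mult b n : ℝ) : ℂ) *
      (1 / (w - v - (b n)⁻¹) - 1 / (0 - (b n)⁻¹))).im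
      = -(GenusOneLogDerivC3g41.mult b n * pairTerm v (v + (b n)⁻¹)) := by
    intro n
    rw [Complex.im_ofReal_mul]
    have e1 : w - v - (b n)⁻¹ = conj v - (v + (b n)⁻¹) := by rw [hwdef]; ring
    have e2 : (0 : ℂ) - (b n)⁻¹ = v - (v + (b n)⁻¹) := by ring
    rw [e1, e2, one_div, one_div, im_twoPoint_term]
    ring
  simp only [hterm] at him
  rw [tsum_neg] at him
  have hsumR : Summable (fun n => GenusOneLogDerivC3g41.mult b n * pairTerm v (v + (b n)⁻¹)) := by
    have h1 := (Complex.hasSum_im hsumZ.hasSum).summable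
    simp only [hterm] at h1
    simpa using h1.neg
  -- Im L = Im K + 1/(2y)
  have hLim : L.im = (newtonK f j v).im + 1 / (2 * v.im) := by
    rw [hLv, Complex.sub_im, hwdef]
    have him' : (v - conj v).im = 2 * v.im := by simp [two_mul]
    have hre' : (v - conj v).re = 0 := by simp
    have hns : Complex.normSq (v - conj v) = (2 * v.im) ^ 2 := by
      rw [Complex.normSq_apply, hre', him']; ring
    rw [one_div, Complex.inv_im, him', hns]
    have hy : v.im ≠ 0 := hv.ne'
    field_simp
    ring
  have hmainN : 2 * coverIndex f j v =
      v.im * ∑' n, GenusOneLogDerivC3g41.mult b n * pairTerm v (v + (b n)⁻¹) := by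
    have h2 : 2 * L.im = ∑' n, GenusOneLogDerivC3g41.mult b n * pairTerm v (v + (b n)⁻¹) := by linarith
    unfold coverIndex
    have hy : v.im ≠ 0 := hv.ne'
    rw [← h2, hLim]
    field_simp
  -- restrict to the genuine zeros
  have hmult1 : ∀ i : {n : ℕ // b n ≠ 0}, GenusOneLogDerivC3g41.mult b i.1 = 1 := fun i => by
    simp [GenusOneLogDerivC3g41.mult, i.2]
  have hsupp : Function.support (fun n => GenusOneLogDerivC3g41.mult b n * pairTerm v (v + (b n)⁻¹)) ⊆
      {n : ℕ | b n ≠ 0} := by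
    intro n hn
    simp only [Function.mem_support, ne_eq] at hn
    intro hb0
    apply hn
    simp [GenusOneLogDerivC3g41.mult, hb0]
  have htsum : ∑' n, GenusOneLogDerivC3g41.mult b n * pairTerm v (v + (b n)⁻¹) =
      ∑' i : {n : ℕ // b n ≠ 0}, pairTerm v (v + (b i.1)⁻¹) := by
    rw [← tsum_subtype_eq_of_support_subset hsupp]
    exact tsum_congr fun i => by rw [hmult1 i, one_mul]
  have hsumI : Summable (fun i : {n : ℕ // b n ≠ 0} => pairTerm v (v + (b i.1)⁻¹)) := by
    have h1 := hsumR.subtype {n : ℕ | b n ≠ 0}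
    refine h1.congr fun i => ?_
    simp only [Function.comp_apply]
    rw [hmult1 i, one_mul]
  refine ⟨{n : ℕ // b n ≠ 0}, fun i => v + (b i.1)⁻¹, fun i => ?_, hsumI, ?_⟩
  · have hbi : b i.1 ≠ 0 := i.2
    have hci_v : v + (b i.1)⁻¹ ≠ v := by
      intro e
      apply hbi
      have : (b i.1)⁻¹ = 0 := by simpa using e
      exact inv_eq_zero.1 this
    have hGi : g (v + (b i.1)⁻¹) = 0 := by
      have := hzero i.1 hbi
      simpa [hGdef, add_comm] using this
    have hci_w : v + (b i.1)⁻¹ ≠ w := by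
      intro e
      rw [e] at hGi
      exact hgw hGi
    refine ⟨?_, hci_v, by rw [← hwdef]; exact hci_w⟩
    have hq := hgval2 _ hci_v hci_w
    rw [hGi] at hq
    have hden : (v + (b i.1)⁻¹ - v) * (v + (b i.1)⁻¹ - w) ≠ 0 :=
      mul_ne_zero (sub_ne_zero.2 hci_v) (sub_ne_zero.2 hci_w)
    exact (div_eq_zero_iff.1 hq.symm).resolve_right hden
  · rw [hmainN, htsum]


/-- (S1) in the ROUTE'S FRAME: `EngineHyps5` (real entire, genus-one growth) + a level-`j` band state + `f^{(j+1)}(v) ≠ 0`. -/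
theorem coverIndexPairSum_of_frame {η : ℝ} {f : ℂ → ℂ} {x₀ s hmax R Hs : ℝ} {B j : ℕ} {v : ℂ}
    (hE : EngineHyps5 2 η f x₀ s hmax R Hs B) (hv : StTrkDQ η f x₀ s hmax R Hs B j v)
    (hz : iteratedDeriv (j + 1) f v ≠ 0) : CoverIndexPairSum f j v := by
  have hf : Summit.RiemannHypothesis.RiemannHypothesis.Theorems.Splittings.JensenWindow.RealEntireLt2 f :=
    realEntireLt2_of_hyps hE
  obtain ⟨ρ, C, hρ0, hρ, hgr⟩ := hf.growth
  obtain ⟨ρ', C', -, hρ', hgr'⟩ := Literature.Analysis.Complex.exists_growth_iteratedDeriv hf.diff hρ0 hρ hgr j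
  have hFd : Differentiable ℂ (iteratedDeriv j f) := differentiable_iteratedDeriv_of_entire hE.1 j
  have hv' : StColQ' η f x₀ s hmax R Hs B j v := hv
  obtain ⟨-, hFv, hy, -⟩ := hv'
  have hderiv : deriv (iteratedDeriv j f) v ≠ 0 := by
    rw [← iteratedDeriv_succ]; exact hz
  have hsimple : analyticOrderAt (iteratedDeriv j f) v = 1 :=
    (hFd.analyticAt v).analyticOrderAt_eq_one_of_zero_deriv_ne_zero hFv hderiv
  have hreal : ∀ z, iteratedDeriv j f (conj z) = conj (iteratedDeriv j f z) :=
    Literature.NumberTheory.LFunctions.iteratedDeriv_conj_of_conj (apply_conj_eq_conj hf.diff hf.real) j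
  exact coverIndexPairSum_of_growth hFd hgr' hρ' hreal hy hFv hsimple

/-- ★ PIECE R (cover criterion), UNCONDITIONAL in the frame: a band state with `f^{(j+1)}(v) ≠ 0` and POSITIVE COVER INDEX is
covered — some zero pair `{c, c̄}` of `f^{(j)}` has `v` strictly inside its Jensen disc. -/
theorem exists_cover_of_coverIndex_pos_frame {η : ℝ} {f : ℂ → ℂ} {x₀ s hmax R Hs : ℝ} {B j : ℕ} {v : ℂ}
    (hE : EngineHyps5 2 η f x₀ s hmax R Hs B) (hv : StTrkDQ η f x₀ s hmax R Hs B j v)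
    (hz : iteratedDeriv (j + 1) f v ≠ 0) (hι : 0 < coverIndex f j v) :
    ∃ c : ℂ, iteratedDeriv j f c = 0 ∧ c ≠ v ∧ c ≠ conj v ∧ (v.re - c.re) ^ 2 + v.im ^ 2 < c.im ^ 2 := by
  have hv' : StColQ' η f x₀ s hmax R Hs B j v := hv
  exact exists_cover_of_coverIndex_pos (coverIndexPairSum_of_frame hE hv hz) hv'.2.2.1 hι

/-- ★ WEAK FIELD ⇒ COVERED (B2 + R), unconditional in the frame: `‖K‖·Im v < ½` forces a covering zero pair. -/
theorem exists_cover_of_weak_frame {η : ℝ} {f : ℂ → ℂ} {x₀ s hmax R Hs : ℝ} {B j : ℕ} {v : ℂ}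
    (hE : EngineHyps5 2 η f x₀ s hmax R Hs B) (hv : StTrkDQ η f x₀ s hmax R Hs B j v)
    (hz : iteratedDeriv (j + 1) f v ≠ 0) (hκ : fieldStrength f j v < 1 / 2) :
    ∃ c : ℂ, iteratedDeriv j f c = 0 ∧ c ≠ v ∧ c ≠ conj v ∧ (v.re - c.re) ^ 2 + v.im ^ 2 < c.im ^ 2 := by
  have hv' : StColQ' η f x₀ s hmax R Hs B j v := hv
  exact exists_cover_of_coverIndex_pos_frame hE hv hz (coverIndex_pos_of_weak hv'.2.2.1 hκ)

/-- ★ ROOF LOCALISATION in the frame: the zeros of `f^{(j)}` off `{v, v̄}` are listed so that for every finset `S` of list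
indices containing the covering ones, each at distance `≥ d₁ > 0` from `v` together with its conjugate, `2ι·d₁ ≤ Im v · #S`. -/
theorem roof_localisation_frame {η : ℝ} {f : ℂ → ℂ} {x₀ s hmax R Hs : ℝ} {B j : ℕ} {v : ℂ}
    (hE : EngineHyps5 2 η f x₀ s hmax R Hs B) (hv : StTrkDQ η f x₀ s hmax R Hs B j v)
    (hz : iteratedDeriv (j + 1) f v ≠ 0) :
    ∃ (I : Type) (a : I → ℂ), (∀ i, iteratedDeriv j f (a i) = 0 ∧ a i ≠ v ∧ a i ≠ conj v) ∧
      ∀ (S : Finset I) (d₁ : ℝ), 0 < d₁ →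
        (∀ i, (v.re - (a i).re) ^ 2 + v.im ^ 2 < (a i).im ^ 2 → i ∈ S) →
        (∀ i ∈ S, d₁ ≤ ‖v - a i‖ ∧ d₁ ≤ ‖v - conj (a i)‖) →
        2 * coverIndex f j v * d₁ ≤ v.im * S.card := by
  have hv' : StColQ' η f x₀ s hmax R Hs B j v := hv
  obtain ⟨I, a, ha, hsum, hid⟩ := coverIndexPairSum_of_frame hE hv hz
  exact ⟨I, a, ha, fun S d₁ hd₁ hcov hd => coverIndex_mul_dist_le hv'.2.2.1 ha hsum hid S hcov hd₁ hd⟩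


/-! ## §11 NAMED NEWTON-SCALE NUMBERS and N♭ IN COORDINATES (B7)

The two zero-configuration clauses shared by N♯ and N♭ and N♭'s frame clause, NAMED (verbatim sub-terms of `NewtonNumbersSharpWith` /
`NewtonNumbersChildWith` at `K = newtonK f j v`), so that the cells of §12 are one-line configuration statements. -/

/-- The EXACT END NUMBER at Newton scale `r = (1+ρ₀)/‖K‖`: `(1+ρ₀)·(r·Σ_c ord_g(c)/((‖v−c‖ − r)‖v−c‖))`, `g := dslope (f^{(j)}) v`
(the END clause of N♯/N♭ is `endNumber f j v ρ₀ < ρ₀‖K‖`).  Its light-cone bound `≤ 2(1+ρ₀)²S₂/‖K‖` under `2r`-separation is (E1). -/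
noncomputable def endNumber (f : ℂ → ℂ) (j : ℕ) (v : ℂ) (ρ₀ : ℝ) : ℝ :=
  (1 + ρ₀) * ((1 + ρ₀) / ‖newtonK f j v‖ *
    ∑' c : ℂ, (analyticOrderNatAt (dslope (iteratedDeriv j f) v) c : ℝ) / ((‖v - c‖ - (1 + ρ₀) / ‖newtonK f j v‖) * ‖v - c‖))

/-- SEPARATION at Newton scale with margin `δ`: every zero of the cofactor is at distance `≥ (1+ρ₀)/‖K‖ + δ` from `v`. -/
def NewtonSep (f : ℂ → ℂ) (j : ℕ) (v : ℂ) (ρ₀ δ : ℝ) : Prop :=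
  ∀ c : ℂ, dslope (iteratedDeriv j f) v c = 0 → (1 + ρ₀) / ‖newtonK f j v‖ + δ ≤ ‖v - c‖

/-- BAND SLACK CHARGED AT THE CHILD's worst corner (N♭'s seventh clause at `K = newtonK f j v`). In coordinates the height part is (B6). -/
def ChildCornerSlack (f : ℂ → ℂ) (x₀ R Hs : ℝ) (j : ℕ) (v : ℂ) (ρ₀ : ℝ) : Prop :=
  (max (|(v - (newtonK f j v)⁻¹).re - x₀| + ρ₀ / ‖newtonK f j v‖ - R / 2) 0) ^ 2
      + ((j : ℝ) + 1) * (|(v - (newtonK f j v)⁻¹).im| + ρ₀ / ‖newtonK f j v‖) ^ 2 ≤ ((j : ℝ) + 1) * Hs ^ 2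

/-- (B4′) the child's height in ABSOLUTE VALUE: `|Im(v − K⁻¹)|·κ² = y·|Δ|`. -/
theorem abs_newtonChild_im {f : ℂ → ℂ} {j : ℕ} {v : ℂ} (hv : 0 < v.im) (hK0 : newtonK f j v ≠ 0) :
    |(v - (newtonK f j v)⁻¹).im| * fieldStrength f j v ^ 2
      = v.im * |fieldStrength f j v ^ 2 + coverIndex f j v - 1 / 2| := by
  have hh := newtonChild_im hv hK0
  have hκ2 : 0 ≤ fieldStrength f j v ^ 2 := sq_nonneg _
  have h1 : |(v - (newtonK f j v)⁻¹).im * fieldStrength f j v ^ 2|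
      = |v.im * (fieldStrength f j v ^ 2 + coverIndex f j v - 1 / 2)| := by rw [hh]
  rw [abs_mul, abs_mul, abs_of_nonneg hκ2, abs_of_pos hv] at h1
  exact h1

/-- (B7) N♭ IN COORDINATES (PROVED repackaging): `0 < κ`, the off-axis clause as `ρ₀κ ≤ |Δ|` ((B4′)), separation, the exact END number,
and the child corner slack give `NewtonNumbersChild`, hence a successor (`succ_of_newtonNumbersChild`). -/
theorem newtonNumbersChild_of_coordinates {f : ℂ → ℂ} {x₀ R Hs : ℝ} {j : ℕ} {v : ℂ} (hv : 0 < v.im)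
    {ρ₀ δ : ℝ} (hρ₀ : 0 < ρ₀) (hδ : 0 < δ) (hκ : 0 < fieldStrength f j v)
    (hoff : ρ₀ * fieldStrength f j v ≤ |fieldStrength f j v ^ 2 + coverIndex f j v - 1 / 2|)
    (hsep : NewtonSep f j v ρ₀ δ) (hend : endNumber f j v ρ₀ < ρ₀ * ‖newtonK f j v‖)
    (hS : ChildCornerSlack f x₀ R Hs j v ρ₀) :
    NewtonNumbersChild f x₀ R Hs j v := by
  have hnK : 0 < ‖newtonK f j v‖ := by
    unfold fieldStrength at hκ
    by_contra h
    push Not at h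
    have : ‖newtonK f j v‖ = 0 := le_antisymm h (norm_nonneg _)
    rw [this, zero_mul] at hκ
    exact lt_irrefl _ hκ
  have hK0 : newtonK f j v ≠ 0 := norm_pos_iff.mp hnK
  refine ⟨ρ₀, δ, hK0, hρ₀, ?_, hδ, hsep, hend, hS⟩
  have habs := abs_newtonChild_im hv hK0
  have hκ2 : 0 < fieldStrength f j v ^ 2 := by positivity
  have hρ : ρ₀ / ‖newtonK f j v‖ * fieldStrength f j v ^ 2 = ρ₀ * v.im * fieldStrength f j v := by
    unfold fieldStrength; field_simp
  refine le_of_mul_le_mul_right ?_ hκ2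
  rw [hρ, habs]
  have := mul_le_mul_of_nonneg_left hoff hv.le
  nlinarith [this]

/-- (B3′) N♯ IN COORDINATES with the named numbers (wrapper of (B3)). -/
theorem newtonNumbersSharp_of_coordinates' {f : ℂ → ℂ} {j : ℕ} {v : ℂ} (hv : 0 < v.im)
    {ρ₀ δ : ℝ} (hρ₀ : 0 < ρ₀) (hδ : 0 < δ)
    (hρκ : ρ₀ ≤ fieldStrength f j v)
    (hmargin : 2 * coverIndex f j v ≤ ρ₀ ^ 2 - 2 * ρ₀ * fieldStrength f j v)
    (hoff : ρ₀ * fieldStrength f j v ≤ fieldStrength f j v ^ 2 + coverIndex f j v - 1 / 2)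
    (hsep : NewtonSep f j v ρ₀ δ) (hend : endNumber f j v ρ₀ < ρ₀ * ‖newtonK f j v‖) :
    NewtonNumbersSharp f j v := by
  have hκ : 0 < fieldStrength f j v := lt_of_lt_of_le hρ₀ hρκ
  have hnK : 0 < ‖newtonK f j v‖ := by
    unfold fieldStrength at hκ
    by_contra h
    push Not at h
    have : ‖newtonK f j v‖ = 0 := le_antisymm h (norm_nonneg _)
    rw [this, zero_mul] at hκ
    exact lt_irrefl _ hκ
  exact newtonNumbersSharp_of_coordinates hv (norm_pos_iff.mp hnK) hρ₀ hδ hρκ hmargin hoff hsep hend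

/-! ## §12 THE CELLS — a typed regime partition of the scope of the SUCC law, in the coordinates `(ι, κ, Δ)` + indicators

Every cell is a CONFIGURATION statement about level `j` (the field `K` at `v`, the zeros of `f^{(j)}`, the frame) or about the REAL TRACE of
`f^{(j+1)}` — never a level-`(j+1)` state, never a socket's conclusion.  `cells_cover` is a tautology: the partition COVERS by construction. -/

/-- CELL «COV»: POSITIVE COVER INDEX — by (S1)+(R) some zero pair `{c, c̄}` of `f^{(j)}` has `v` strictly inside its Jensen disc. -/
def CellCov (f : ℂ → ℂ) (j : ℕ) (v : ℂ) : Prop := 0 < coverIndex f j v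

/-- CELL «F» (Jensen–Newton FLOOR certificate = N♯'s availability window with the EXACT END number; frame-free):
`ρ₀ ≤ κ`, `2ι ≤ ρ₀² − 2ρ₀κ` (Newton disc inside `v`'s Jensen disc, (B1)), `ρ₀κ ≤ Δ` (off-axis), separation, `endNumber < ρ₀‖K‖`.
(Forces `ι < 0`: the rhs of the margin clause is `ρ₀(ρ₀ − 2κ) ≤ −ρ₀κ < 0`.) -/
def CellF (f : ℂ → ℂ) (j : ℕ) (v : ℂ) : Prop :=
  ∃ ρ₀ δ : ℝ, 0 < ρ₀ ∧ 0 < δ ∧ ρ₀ ≤ fieldStrength f j v ∧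
    2 * coverIndex f j v ≤ ρ₀ ^ 2 - 2 * ρ₀ * fieldStrength f j v ∧
    ρ₀ * fieldStrength f j v ≤ fieldStrength f j v ^ 2 + coverIndex f j v - 1 / 2 ∧
    NewtonSep f j v ρ₀ δ ∧ endNumber f j v ρ₀ < ρ₀ * ‖newtonK f j v‖

/-- CELL «N♭» (CHILD FIT): `0 < κ`, `ρ₀κ ≤ |Δ|` (the Newton disc of radius `ρ₀/‖K‖` about the child misses the axis), separation, the
exact END number, and band slack at the child's worst corner. -/
def CellNb (f : ℂ → ℂ) (x₀ R Hs : ℝ) (j : ℕ) (v : ℂ) : Prop :=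
  ∃ ρ₀ δ : ℝ, 0 < ρ₀ ∧ 0 < δ ∧ 0 < fieldStrength f j v ∧
    ρ₀ * fieldStrength f j v ≤ |fieldStrength f j v ^ 2 + coverIndex f j v - 1 / 2| ∧
    NewtonSep f j v ρ₀ δ ∧ endNumber f j v ρ₀ < ρ₀ * ‖newtonK f j v‖ ∧ ChildCornerSlack f x₀ R Hs j v ρ₀

/-- LANDING DIP (indicator; data = the real trace of `f^{(j+1)}` only, exactly `RhW08.LandingDoor.LandingTaylor`'s point data without its
radius / `M₃` / margin / depth clauses): a critical point `x⋆` of the trace within `2·Im v` of `Re v`, `m := f^{(j+1)}(x⋆)`,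
`2A := f^{(j+3)}(x⋆)`, with `m·A > 0` (a NON-CROSSING DIP of `|f^{(j+1)}|`: the signature of a child pair about to land at `x⋆`). -/
def LandingDip (f : ℂ → ℂ) (j : ℕ) (v : ℂ) : Prop :=
  ∃ xs m A : ℝ, |xs - v.re| < 2 * v.im ∧ (m : ℂ) = iteratedDeriv (j + 1) f xs ∧ iteratedDeriv (j + 2) f xs = 0 ∧
    ((2 * A : ℝ) : ℂ) = iteratedDeriv (j + 3) f xs ∧ 0 < m * A

/-- CELL «L» (LANDING): un-covered, no floor certificate, no child fit, and a landing dip under `v`. -/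
def CellL (f : ℂ → ℂ) (x₀ R Hs : ℝ) (j : ℕ) (v : ℂ) : Prop :=
  coverIndex f j v ≤ 0 ∧ ¬ CellF f j v ∧ ¬ CellNb f x₀ R Hs j v ∧ LandingDip f j v

/-- CELL «E» (ELSE ⁄ grazing): un-covered, no floor certificate, no child fit, NO landing dip under `v`. -/
def CellE (f : ℂ → ℂ) (x₀ R Hs : ℝ) (j : ℕ) (v : ℂ) : Prop :=
  coverIndex f j v ≤ 0 ∧ ¬ CellF f j v ∧ ¬ CellNb f x₀ R Hs j v ∧ ¬ LandingDip f j v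

/-- ★ COVERAGE (tautological): the five cells cover. -/
theorem cells_cover (f : ℂ → ℂ) (x₀ R Hs : ℝ) (j : ℕ) (v : ℂ) :
    CellCov f j v ∨ CellF f j v ∨ CellNb f x₀ R Hs j v ∨ CellL f x₀ R Hs j v ∨ CellE f x₀ R Hs j v := by
  by_cases hC : CellCov f j v
  · exact Or.inl hC
  have hι : coverIndex f j v ≤ 0 := not_lt.mp hC
  by_cases hF : CellF f j v
  · exact Or.inr (Or.inl hF)
  by_cases hN : CellNb f x₀ R Hs j v
  · exact Or.inr (Or.inr (Or.inl hN))
  by_cases hD : LandingDip f j v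
  · exact Or.inr (Or.inr (Or.inr (Or.inl ⟨hι, hF, hN, hD⟩)))
  · exact Or.inr (Or.inr (Or.inr (Or.inr ⟨hι, hF, hN, hD⟩)))

/-- The floor cell lies in the UN-COVERED half-plane: `CellF → ι < 0`. -/
theorem coverIndex_neg_of_cellF {f : ℂ → ℂ} {j : ℕ} {v : ℂ} (h : CellF f j v) : coverIndex f j v < 0 := by
  obtain ⟨ρ₀, δ, hρ₀, -, hρκ, hmargin, -, -, -⟩ := h
  nlinarith

/-- An un-covered state has field strength `κ ≥ ½` ((B2)): the weak-field regime is inside COV. -/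
theorem half_le_fieldStrength_of_not_cellCov {f : ℂ → ℂ} {j : ℕ} {v : ℂ} (hv : 0 < v.im) (h : ¬ CellCov f j v) :
    1 / 2 ≤ fieldStrength f j v :=
  half_le_fieldStrength_of_uncovered hv (not_lt.mp h)

/-! ## §13 THE REGIME LEMMAS — two PROVED (successor currency), three OPEN (Q8-door currency, named owners) -/

/-- ★★ REGIME F (PROVED): a legal frame, a band state `v` in cell F ⇒ the successor state (door N♯). -/
theorem regime_F {η : ℝ} {f : ℂ → ℂ} {x₀ s hmax R Hs : ℝ} {B j : ℕ} {v : ℂ}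
    (hE : EngineHyps5 2 η f x₀ s hmax R Hs B) (hv : StTrkDQ η f x₀ s hmax R Hs B j v) (hF : CellF f j v) :
    ∃ u : ℂ, StTrkDQ η f x₀ s hmax R Hs B (j + 1) u := by
  have hv' : StColQ' η f x₀ s hmax R Hs B j v := hv
  obtain ⟨ρ₀, δ, hρ₀, hδ, hρκ, hmargin, hoff, hsep, hend⟩ := hF
  exact succ_of_newtonNumbersSharp hE hv
    (newtonNumbersSharp_of_coordinates' hv'.2.2.1 hρ₀ hδ hρκ hmargin hoff hsep hend)

/-- ★★ REGIME N♭ (PROVED): a legal frame, a band state `v` in cell N♭ ⇒ the successor state (door N♭). -/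
theorem regime_Nb {η : ℝ} {f : ℂ → ℂ} {x₀ s hmax R Hs : ℝ} {B j : ℕ} {v : ℂ}
    (hE : EngineHyps5 2 η f x₀ s hmax R Hs B) (hv : StTrkDQ η f x₀ s hmax R Hs B j v) (hN : CellNb f x₀ R Hs j v) :
    ∃ u : ℂ, StTrkDQ η f x₀ s hmax R Hs B (j + 1) u := by
  have hv' : StColQ' η f x₀ s hmax R Hs B j v := hv
  obtain ⟨ρ₀, δ, hρ₀, hδ, hκ, hoff, hsep, hend, hS⟩ := hN
  exact succ_of_newtonNumbersChild hE hv
    (newtonNumbersChild_of_coordinates hv'.2.2.1 hρ₀ hδ hκ hoff hsep hend hS)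

/-! ## §13b (v2) THE JENSEN DIP LEMMA — owner of cell «L» (deep part), PROVED

Real-axis dual of the tree's PROVED `Literature.Analysis.Complex.jensen_circle` (Jensen 1913 / Pólya): at a NON-CROSSING DIP of `|g|` on the
axis (`g x ≠ 0`, `g′ x = 0`, `Re (g″x/gx) > 0`) the point `x` lies in the open Jensen disc of some zero of `g` — because off every open disc each
pole term of `(g′/g)′(x) = −Σ m(a)(x−a)⁻² + ψ_R′(x)` has real part `≤ 0` and `ψ_R′ → 0` (Titchmarsh Lemma α at centre `x`,
`Literature.Analysis.Complex.titchmarsh_logDeriv_sub_sum`, error `tendsto_growth_div_sq`).  Consequence in the frame: ANY non-crossing dip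
of `f^{(j+1)}` at a real `xs` with `|xs − x₀| + Hs ≤ R/2` yields a successor (`succ_of_dip_deep`; strip heredity `analyticHeredity_landed`
bounds the cone zero's height by `Hs`, the cone bounds its abscissa by `xs ± Hs`).  No Rouché circle, no margin, no door. -/

section JensenDipSec

open Filter Metric Topology

/-! ### §13b.1 Algebra of one pole term -/

/-- `Re (w²)⁻¹ < 0 ⟹ |Re w| < |Im w|` (the 45° cone). -/
theorem abs_re_lt_abs_im_of_re_inv_sq_neg {w : ℂ} (h : ((w ^ 2)⁻¹).re < 0) : |w.re| < |w.im| := by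
  rw [Complex.inv_re] at h
  have hns : 0 ≤ Complex.normSq (w ^ 2) := Complex.normSq_nonneg _
  have hre : (w ^ 2).re = w.re ^ 2 - w.im ^ 2 := by
    rw [sq, Complex.mul_re]; ring
  have hneg : (w ^ 2).re < 0 := by
    by_contra hcon
    push Not at hcon
    have : 0 ≤ (w ^ 2).re / Complex.normSq (w ^ 2) := div_nonneg hcon hns
    linarith
  rw [hre] at hneg
  exact sq_lt_sq.1 (by linarith)

/-- The pole term `m/(z − a)` has derivative `−m/(x − a)²` at `x ≠ a`. -/
theorem hasDerivAt_poleTerm (m : ℂ) {x a : ℂ} (hxa : x ≠ a) :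
    HasDerivAt (fun z : ℂ => m / (z - a)) (-(m / (x - a) ^ 2)) x := by
  have hsub : HasDerivAt (fun z : ℂ => z - a) 1 x := (hasDerivAt_id x).sub_const a
  have hne : x - a ≠ 0 := sub_ne_zero.2 hxa
  have hinv := hsub.inv hne
  have h := hinv.const_mul m
  have e : (fun z : ℂ => m / (z - a)) = fun z => m * (z - a)⁻¹ := by
    funext z; rw [div_eq_mul_inv]
  rw [e]
  refine h.congr_deriv ?_
  field_simp

/-! ### §13b.2 The Jensen dip lemma -/

/-- **JENSEN DIP LEMMA.**  `g` entire with `‖g z‖ ≤ C e^{‖z‖^ρ}` (`0 ≤ ρ < 2`); at a real point `x` with `g x ≠ 0`, `g′ x = 0` and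
`0 < Re (g″ x / g x)` there is a zero `a` of `g` whose open Jensen disc contains `x`: `|x − Re a| < |Im a|`.
[Jensen 1913 / Pólya: the real-axis sign of `(g′/g)′` off the Jensen discs; proof via Titchmarsh1986 §3.9 Lemma α] -/
theorem jensenDip {g : ℂ → ℂ} (hg : Differentiable ℂ g) {ρ C : ℝ} (hρ0 : 0 ≤ ρ) (hρ : ρ < 2)
    (hgr : ∀ z, ‖g z‖ ≤ C * Real.exp (‖z‖ ^ ρ)) {x : ℝ} (hx : g x ≠ 0) (hx1 : deriv g x = 0)
    (hx2 : 0 < (deriv (deriv g) x / g x).re) :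
    ∃ a : ℂ, g a = 0 ∧ |x - a.re| < |a.im| := by
  classical
  have hCpos : 0 < C := growthConst_pos hgr hx
  have hgx : 0 < ‖g (x : ℂ)‖ := norm_pos_iff.2 hx
  set δ : ℝ := (deriv (deriv g) x / g x).re with hδ
  set K : ℝ := Real.log C - Real.log ‖g (x : ℂ)‖ + 1 with hK
  -- choose `R` with the Titchmarsh error below `δ`
  have hlim : Tendsto (fun R : ℝ ↦ 64 * ((K + (|x| + 2 * R) ^ ρ) / R ^ 2)) atTop (𝓝 0) := by
    simpa using (tendsto_growth_div_sq K x hρ0 hρ).const_mul 64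
  obtain ⟨R, hRδ, hRge⟩ := ((hlim.eventually_lt_const hx2).and (eventually_ge_atTop (1 : ℝ))).exists
  have hRpos : 0 < R := by linarith
  set M : ℝ := C * Real.exp ((|x| + 2 * R) ^ ρ) with hM
  obtain ⟨S, m, ψ, hS, hS', hψd, hψeq, -, hψ'⟩ :=
    titchmarsh_logDeriv_sub_sum hg hx hRpos (norm_le_on_closedBall hρ0 hgr x R)
  have hlog : Real.log (M / ‖g (x : ℂ)‖) + 1 = K + (|x| + 2 * R) ^ ρ := by
    rw [hK, hM, Real.log_div (by positivity) hgx.ne', Real.log_mul hCpos.ne' (Real.exp_pos _).ne',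
      Real.log_exp]
    ring
  -- `x ∉ S` (no zero at `x`)
  have hxS : ∀ a ∈ S, (x : ℂ) ≠ a := by
    intro a ha hxa; exact hx (by rw [hxa]; exact (hS a ha).1)
  -- the identity `g′/g = Σ m/(z − a) + ψ` holds on a neighbourhood of `x`
  have hball : ball (x : ℂ) R ∈ 𝓝 (x : ℂ) := isOpen_ball.mem_nhds (mem_ball_self hRpos)
  have hne_nhds : ∀ᶠ z in 𝓝 (x : ℂ), g z ≠ 0 :=
    (hg.continuous.continuousAt (x := (x : ℂ))).eventually_ne hx
  have hEq : (fun z => deriv g z / g z) =ᶠ[𝓝 (x : ℂ)] fun z => (∑ a ∈ S, (m a : ℂ) / (z - a)) + ψ z := by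
    filter_upwards [hball, hne_nhds] with z hz hz0
    rw [hψeq z hz hz0]; ring
  -- derivative of the left side at `x`
  have hdg : Differentiable ℂ (deriv g) := by
    have := differentiable_iteratedDeriv_of_entire hg 1
    simpa [iteratedDeriv_one] using this
  have hL : HasDerivAt (fun z => deriv g z / g z) (deriv (deriv g) x / g x) x := by
    have h : HasDerivAt (fun z => deriv g z / g z)
        ((deriv (deriv g) x * g x - deriv g x * deriv g x) / g x ^ 2) x :=
      (hdg.differentiableAt.hasDerivAt (x := (x : ℂ))).div (hg.differentiableAt.hasDerivAt) hx
    refine h.congr_deriv ?_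
    rw [hx1]; field_simp; ring
  -- derivative of the right side at `x`
  have hR : HasDerivAt (fun z => (∑ a ∈ S, (m a : ℂ) / (z - a)) + ψ z)
      ((∑ a ∈ S, -((m a : ℂ) / (x - a) ^ 2)) + deriv ψ x) x := by
    have hsum : HasDerivAt (fun z => ∑ a ∈ S, (m a : ℂ) / (z - a)) (∑ a ∈ S, -((m a : ℂ) / (x - a) ^ 2)) x := by
      have h := HasDerivAt.sum (fun a ha => hasDerivAt_poleTerm (m a : ℂ) (hxS a ha))
      rwa [Finset.sum_fn] at h
    have hψx : HasDerivAt ψ (deriv ψ x) x :=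
      (hψd.differentiableAt hball).hasDerivAt
    exact hsum.add hψx
  -- the two derivatives agree
  have hderiv_eq : deriv (deriv g) x / g x = (∑ a ∈ S, -((m a : ℂ) / (x - a) ^ 2)) + deriv ψ x := by
    have h1 := hL.deriv
    have h2 : deriv (fun z => deriv g z / g z) x = (∑ a ∈ S, -((m a : ℂ) / (x - a) ^ 2)) + deriv ψ x := by
      rw [hEq.deriv_eq]; exact hR.deriv
    rw [← h1, h2]
  -- real parts: if every pole term had `Re (x − a)⁻² ≥ 0` we would get `δ ≤ ‖ψ′ x‖ < δ`
  by_contra hcone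
  push Not at hcone
  have hterm : ∀ a ∈ S, 0 ≤ ((m a : ℂ) / ((x : ℂ) - a) ^ 2).re := by
    intro a ha
    have hma : ((m a : ℂ) / ((x : ℂ) - a) ^ 2) = (m a : ℝ) * (((x : ℂ) - a) ^ 2)⁻¹ := by
      rw [div_eq_mul_inv]; norm_cast
    rw [hma, Complex.re_ofReal_mul]
    apply mul_nonneg (Nat.cast_nonneg _)
    by_contra hneg
    push Not at hneg
    have hc := abs_re_lt_abs_im_of_re_inv_sq_neg hneg
    have : |x - a.re| < |a.im| := by simpa using hc
    exact absurd this (not_lt.2 (hcone a (hS a ha).1))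
  have hre : δ = (∑ a ∈ S, -((m a : ℂ) / (x - a) ^ 2)).re + (deriv ψ x).re := by
    rw [hδ, hderiv_eq, Complex.add_re]
  rw [Complex.re_sum] at hre
  have hsum_nonpos : ∑ a ∈ S, (-((m a : ℂ) / ((x : ℂ) - a) ^ 2)).re ≤ 0 := by
    apply Finset.sum_nonpos
    intro a ha
    rw [Complex.neg_re]
    linarith [hterm a ha]
  have hψre : (deriv ψ x).re ≤ 64 * ((K + (|x| + 2 * R) ^ ρ) / R ^ 2) := by
    have hxin : (x : ℂ) ∈ closedBall (x : ℂ) (R / 8) := mem_closedBall_self (by linarith)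
    calc (deriv ψ x).re ≤ ‖deriv ψ x‖ := Complex.re_le_norm _
      _ ≤ 64 * (Real.log (M / ‖g (x : ℂ)‖) + 1) / R ^ 2 := hψ' _ hxin
      _ = 64 * ((K + (|x| + 2 * R) ^ ρ) / R ^ 2) := by rw [hlog]; ring
  have : δ < δ := by
    calc δ = _ := hre
      _ ≤ 0 + 64 * ((K + (|x| + 2 * R) ^ ρ) / R ^ 2) := add_le_add hsum_nonpos hψre
      _ < δ := by rw [zero_add]; exact hRδ
  exact lt_irrefl _ this

/-- The Jensen dip lemma for a REAL entire `g`: the cone zero may be taken in the UPPER half-plane. -/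
theorem jensenDip_pos {g : ℂ → ℂ} (hg : Differentiable ℂ g) {ρ C : ℝ} (hρ0 : 0 ≤ ρ) (hρ : ρ < 2)
    (hgr : ∀ z, ‖g z‖ ≤ C * Real.exp (‖z‖ ^ ρ)) (hreal : ∀ t : ℝ, (g t).im = 0) {x : ℝ} (hx : g x ≠ 0)
    (hx1 : deriv g x = 0) (hx2 : 0 < (deriv (deriv g) x / g x).re) :
    ∃ a : ℂ, g a = 0 ∧ 0 < a.im ∧ |x - a.re| < a.im := by
  obtain ⟨a, ha, hcone⟩ := jensenDip hg hρ0 hρ hgr hx hx1 hx2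
  have him : a.im ≠ 0 := by
    intro h0; rw [h0, abs_zero] at hcone; exact absurd hcone (not_lt.2 (abs_nonneg (x - a.re)))
  rcases lt_or_gt_of_ne him with hneg | hpos
  · refine ⟨conj a, ?_, by simpa using hneg, ?_⟩
    · rw [apply_conj_eq_conj hg hreal a, ha, map_zero]
    · simpa [abs_of_neg hneg] using hcone
  · exact ⟨a, ha, hpos, by simpa [abs_of_pos hpos] using hcone⟩

/-! ### §13b.3 The deep-dip successor -/

/-- **DEEP-DIP SUCCESSOR.**  In the frame, a non-crossing dip of `f^{(j+1)}` at a real point `xs` with `|xs − x₀| + Hs ≤ R/2` gives a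
successor state at level `j+1`.  (Dip data exactly as in the lens-1 cell datum `LandingDip`, minus its localisation `|xs − Re v| < 2·Im v`.) -/
theorem succ_of_dip_deep {η : ℝ} {f : ℂ → ℂ} {x₀ s hmax R Hs : ℝ} {B j : ℕ}
    (hE : EngineHyps5 2 η f x₀ s hmax R Hs B) {xs m A : ℝ}
    (hm : (m : ℂ) = iteratedDeriv (j + 1) f xs) (h2 : iteratedDeriv (j + 2) f xs = 0)
    (hA : ((2 * A : ℝ) : ℂ) = iteratedDeriv (j + 3) f xs) (hmA : 0 < m * A)
    (hdeep : |xs - x₀| + Hs ≤ R / 2) :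
    ∃ u : ℂ, StTrkDQ η f x₀ s hmax R Hs B (j + 1) u := by
  obtain ⟨hdiff, hreal, hgrowth, hs, hsh, hhR, h3R, hHs, hstrip, hHsR, hpair, hcol, hhalf, hη0, hη1, hrem⟩ := hE
  set g : ℂ → ℂ := iteratedDeriv (j + 1) f with hg_def
  have hgd : Differentiable ℂ g := differentiable_iteratedDeriv_of_entire hdiff (j + 1)
  have hgreal : ∀ t : ℝ, (g t).im = 0 := im_iteratedDeriv_ofReal hdiff hreal (j + 1)
  -- growth of `g` in the tree form
  have hC0 : InClass f Hs := ⟨hdiff, hreal, hgrowth, hstrip⟩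
  have hm0 : m ≠ 0 := by
    intro h0; rw [h0, zero_mul] at hmA; exact lt_irrefl _ hmA
  have hgx : g xs ≠ 0 := by
    rw [← hm]; exact_mod_cast hm0
  have hgne : g ≠ 0 := by
    intro h0; exact hgx (by rw [h0]; rfl)
  have hCj : InClass g Hs := analyticHeredity_landed f Hs (j + 1) hHs hC0 hgne
  obtain ⟨ρ', C', hρ'0, hρ', -, hgr'⟩ := StubAnalyticHeredity.growth_treeForm hgd hCj.2.2.1
  -- dip data for `g`
  have hx1 : deriv g xs = 0 := by
    rw [hg_def, ← iteratedDeriv_succ]; exact h2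
  have hx2 : 0 < (deriv (deriv g) xs / g xs).re := by
    have e : deriv (deriv g) = iteratedDeriv (j + 3) f := by
      rw [hg_def, ← iteratedDeriv_succ, ← iteratedDeriv_succ]
    rw [e, ← hA, ← hm]
    have : (((2 * A : ℝ) : ℂ) / (m : ℂ)).re = 2 * A / m := by
      rw [← Complex.ofReal_div, Complex.ofReal_re]
    rw [this]
    rcases lt_or_gt_of_ne hm0 with hneg | hpos
    · have hA' : A < 0 := by nlinarith
      exact div_pos_of_neg_of_neg (by linarith) hneg
    · have hA' : 0 < A := by nlinarith
      exact div_pos (by linarith) hpos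
  obtain ⟨a, ha, ha0, hcone⟩ := jensenDip_pos hgd hρ'0 hρ' hgr' hgreal hgx hx1 hx2
  -- strip and band
  have haHs : a.im ≤ Hs := by
    have := hCj.2.2.2 a ha
    rwa [abs_of_pos ha0] at this
  have hare : |a.re - x₀| ≤ R / 2 := by
    have h1 : |a.re - x₀| ≤ |xs - a.re| + |xs - x₀| := by
      have := abs_sub_le (a.re) xs x₀
      rw [abs_sub_comm a.re xs] at this
      linarith
    linarith [hcone.le]
  have hmax : max (|a.re - x₀| - R / 2) 0 = 0 := max_eq_right (by linarith)
  have hsq : a.im ^ 2 ≤ Hs ^ 2 := by nlinarith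
  have hmul := mul_le_mul_of_nonneg_left hsq (show (0 : ℝ) ≤ ((j + 1 : ℕ) : ℝ) by positivity)
  have hband : (max (|a.re - x₀| - R / 2) 0) ^ 2 + ((j + 1 : ℕ) : ℝ) * a.im ^ 2 ≤ ((j + 1 : ℕ) : ℝ) * Hs ^ 2 := by
    rw [hmax]; simpa using hmul
  exact ⟨a, hgne, ha, ha0, by simpa using hband, haHs⟩


end JensenDipSec

/-- (v2) CELL DATUM «L-deep»: a landing dip under `v` whose abscissa is deep in the column (`|xs − x₀| + Hs ≤ R/2`). -/
def LandingDipDeep (f : ℂ → ℂ) (x₀ R Hs : ℝ) (j : ℕ) (v : ℂ) : Prop :=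
  ∃ xs m A : ℝ, |xs - v.re| < 2 * v.im ∧ (m : ℂ) = iteratedDeriv (j + 1) f xs ∧ iteratedDeriv (j + 2) f xs = 0 ∧
    ((2 * A : ℝ) : ℂ) = iteratedDeriv (j + 3) f xs ∧ 0 < m * A ∧ |xs - x₀| + Hs ≤ R / 2

theorem landingDip_of_deep {f : ℂ → ℂ} {x₀ R Hs : ℝ} {j : ℕ} {v : ℂ} (h : LandingDipDeep f x₀ R Hs j v) : LandingDip f j v := by
  obtain ⟨xs, m, A, h1, h2, h3, h4, h5, -⟩ := h
  exact ⟨xs, m, A, h1, h2, h3, h4, h5⟩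

/-- A landing dip under a state that is itself deep (`|Re v − x₀| + 2·Im v + Hs ≤ R/2`) is a deep dip. -/
theorem landingDipDeep_of_state_deep {f : ℂ → ℂ} {x₀ R Hs : ℝ} {j : ℕ} {v : ℂ} (h : LandingDip f j v)
    (hv : |v.re - x₀| + 2 * v.im + Hs ≤ R / 2) : LandingDipDeep f x₀ R Hs j v := by
  obtain ⟨xs, m, A, h1, h2, h3, h4, h5⟩ := h
  refine ⟨xs, m, A, h1, h2, h3, h4, h5, ?_⟩
  have : |xs - x₀| ≤ |xs - v.re| + |v.re - x₀| := abs_sub_le xs v.re x₀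
  linarith [h1.le]

/-- ★ REGIME LEMMA «L-deep» (PROVED, successor currency): frame + a deep landing dip ⇒ a successor at level `j+1` — by the Jensen dip
lemma (a SIGN argument).  This discharges the deep part of cell L; NO use of `v`'s coordinates, of `DiscOverlap`, or of `¬ReadyR2`. -/
theorem regime_Ldeep {η : ℝ} {f : ℂ → ℂ} {x₀ s hmax R Hs : ℝ} {B j : ℕ} {v : ℂ}
    (hE : EngineHyps5 2 η f x₀ s hmax R Hs B) (h : LandingDipDeep f x₀ R Hs j v) :
    ∃ u : ℂ, StTrkDQ η f x₀ s hmax R Hs B (j + 1) u := by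
  obtain ⟨xs, m, A, -, hm, h2, hA, hmA, hdeep⟩ := h
  exact succ_of_dip_deep hE hm h2 hA hmA hdeep

/-- The six doors of the SUCC law of record (the conclusion of `RhW08.LandingDoor.DoorAvailLawQ8`, named). -/
def Doors8 (f : ℂ → ℂ) (x₀ R Hs : ℝ) (j : ℕ) (v : ℂ) : Prop :=
  NewtonNumbers f x₀ R Hs j v ∨ NewtonNumbersCol f x₀ R Hs j ∨ ClusterNumbersJ' f x₀ R Hs j ∨ ClusterNumbersU f x₀ R j ∨
    RhW08.LandingDoor.LandingNumbers f x₀ R Hs j ∨ CornerWindow f x₀ R Hs j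

/-- Each of the six doors opens (the case analysis of `RhW08.LandingDoor.antiEscapeCore_of_doorAvail8`, at one state). -/
theorem succ_of_doors8 (hRB : RealCritBoundNSig) {η : ℝ} {f : ℂ → ℂ} {x₀ s hmax R Hs : ℝ} {B j : ℕ} {v : ℂ}
    (hE : EngineHyps5 2 η f x₀ s hmax R Hs B) (hlow : IsLowest StTrkDQ η f x₀ s hmax R Hs B j v)
    (hnR : ¬ ReadyR2 η f x₀ s hmax R Hs B j v) (h : Doors8 f x₀ R Hs j v) :
    ∃ u : ℂ, StTrkDQ η f x₀ s hmax R Hs B (j + 1) u := by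
  rcases h with hN | hNc | hC | hU | hLd | hW
  · exact succ_of_newtonNumbers hE hlow.1 hN
  · exact succ_of_newtonNumbersCol hE hlow.1 hNc
  · exact succ_of_clusterNumbersJ' hRB hE hlow.1 hnR hC
  · exact succ_of_clusterNumbersU hE hlow.1 hU
  · exact RhW08.LandingDoor.succ_of_landingNumbers hE hlow.1 hLd
  · exact succ_of_cornerWindow hE hlow.1 hnR hW

/-- The SUCC law of record, pointwise: `DoorAvailLawQ8` is `∀ …, binders → Doors8`. -/
theorem doorAvailLawQ8_iff :
    RhW08.LandingDoor.DoorAvailLawQ8 ↔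
      ∀ (η : ℝ) (f : ℂ → ℂ) (x₀ s hmax R Hs : ℝ) (B : ℕ), EngineHyps5 2 η f x₀ s hmax R Hs B → ∀ (j : ℕ) (v : ℂ),
        IsLowest StTrkDQ η f x₀ s hmax R Hs B j v → ¬ ReadyR2 η f x₀ s hmax R Hs B j v →
        ¬ AllInBandInRangeWindow f x₀ R Hs j v → ¬ Dimple f j v → DiscOverlap f j v →
        iteratedDeriv (j + 1) f v ≠ 0 → Doors8 f x₀ R Hs j v :=
  Iff.rfl

/-- OPEN REGIME «COV» in Q8-door currency: the binders of the law of record, `0 < ι`, AND (PROVED data handed in by the composition) a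
COVERING ZERO PAIR `{c, c̄}` of `f^{(j)}` — produce one of the six doors.  Owners: U (two-body roof pair: `S = {v, c}`-pinned disc at the
midpoint; needs column room and `Im c ≲ 4.24·Im v`), C′ (roofing cluster), W.  Boundary observable: `d₁ := dist(v, nearest roof)` against
`y·#S/(2ι)` (`roof_localisation_frame`), `Im c/Im v`, `‖K(μ)‖·d` at the midpoint `μ`. -/
def RegCov8 : Prop :=
  ∀ (η : ℝ) (f : ℂ → ℂ) (x₀ s hmax R Hs : ℝ) (B : ℕ), EngineHyps5 2 η f x₀ s hmax R Hs B → ∀ (j : ℕ) (v : ℂ),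
    IsLowest StTrkDQ η f x₀ s hmax R Hs B j v → ¬ ReadyR2 η f x₀ s hmax R Hs B j v →
    ¬ AllInBandInRangeWindow f x₀ R Hs j v → ¬ Dimple f j v → DiscOverlap f j v →
    iteratedDeriv (j + 1) f v ≠ 0 → CellCov f j v →
    (∃ c : ℂ, iteratedDeriv j f c = 0 ∧ c ≠ v ∧ c ≠ conj v ∧ (v.re - c.re) ^ 2 + v.im ^ 2 < c.im ^ 2) →
    Doors8 f x₀ R Hs j v

/-- REGIME «F» in Q8-door currency (for the literal composition only; NOT discharged here — N♯ is not a Q8 door, D1). -/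
def RegF8 : Prop :=
  ∀ (η : ℝ) (f : ℂ → ℂ) (x₀ s hmax R Hs : ℝ) (B : ℕ), EngineHyps5 2 η f x₀ s hmax R Hs B → ∀ (j : ℕ) (v : ℂ),
    IsLowest StTrkDQ η f x₀ s hmax R Hs B j v → ¬ ReadyR2 η f x₀ s hmax R Hs B j v →
    ¬ AllInBandInRangeWindow f x₀ R Hs j v → ¬ Dimple f j v → DiscOverlap f j v →
    iteratedDeriv (j + 1) f v ≠ 0 → CellF f j v → Doors8 f x₀ R Hs j v

/-- REGIME «N♭» in Q8-door currency (for the literal composition only; NOT discharged here — N♭ is not a Q8 door, D1). -/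
def RegNb8 : Prop :=
  ∀ (η : ℝ) (f : ℂ → ℂ) (x₀ s hmax R Hs : ℝ) (B : ℕ), EngineHyps5 2 η f x₀ s hmax R Hs B → ∀ (j : ℕ) (v : ℂ),
    IsLowest StTrkDQ η f x₀ s hmax R Hs B j v → ¬ ReadyR2 η f x₀ s hmax R Hs B j v →
    ¬ AllInBandInRangeWindow f x₀ R Hs j v → ¬ Dimple f j v → DiscOverlap f j v →
    iteratedDeriv (j + 1) f v ≠ 0 → CellNb f x₀ R Hs j v → Doors8 f x₀ R Hs j v

/-- OPEN REGIME «L» (LANDING) in Q8-door currency: binders + `ι ≤ 0`, no floor certificate, no child fit, a landing dip under `v` ⇒ a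
door.  Owner L: supply the radius `r` with `2(m/A) ≤ r²`, the bound `M₃` on `D̄(x⋆, r)`, the depth clause and the ONE margin `M₃r³ < |m|`
(`RhW08.LandingDoor.LandingTaylor` ⇒ `LandingNumbers`, plug `regL8_of_landingTaylorLaw`).  Boundary observable: the Taylor margin. -/
def RegL8 : Prop :=
  ∀ (η : ℝ) (f : ℂ → ℂ) (x₀ s hmax R Hs : ℝ) (B : ℕ), EngineHyps5 2 η f x₀ s hmax R Hs B → ∀ (j : ℕ) (v : ℂ),
    IsLowest StTrkDQ η f x₀ s hmax R Hs B j v → ¬ ReadyR2 η f x₀ s hmax R Hs B j v →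
    ¬ AllInBandInRangeWindow f x₀ R Hs j v → ¬ Dimple f j v → DiscOverlap f j v →
    iteratedDeriv (j + 1) f v ≠ 0 → CellL f x₀ R Hs j v → Doors8 f x₀ R Hs j v

/-- (v2) OPEN REGIME «L-edge» in Q8-door currency: cell L WITHOUT a deep dip (the dip abscissa lies within `Hs` of the column edge
`|xs − x₀| = R/2`, for every dip witness) ⇒ a door.  Owner: the QUANTITATIVE Jensen dip (cone height `≤ √(N·m/A)`, `N` = number of zeros of
`f^{(j+1)}` in the cone over `xs`; lands the cone zero inside the level-`(j+1)` window when `|xs − x₀| + √(N·m/A) ≤ R/2 + …`) or door L/U.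
Strictly weaker than `RegL8` (`regLedge8_of_regL8`). -/
def RegLedge8 : Prop :=
  ∀ (η : ℝ) (f : ℂ → ℂ) (x₀ s hmax R Hs : ℝ) (B : ℕ), EngineHyps5 2 η f x₀ s hmax R Hs B → ∀ (j : ℕ) (v : ℂ),
    IsLowest StTrkDQ η f x₀ s hmax R Hs B j v → ¬ ReadyR2 η f x₀ s hmax R Hs B j v →
    ¬ AllInBandInRangeWindow f x₀ R Hs j v → ¬ Dimple f j v → DiscOverlap f j v →
    iteratedDeriv (j + 1) f v ≠ 0 → CellL f x₀ R Hs j v → ¬ LandingDipDeep f x₀ R Hs j v → Doors8 f x₀ R Hs j v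

theorem regLedge8_of_regL8 (hL : RegL8) : RegLedge8 :=
  fun η f x₀ s hmax R Hs B hE j v hlow hnR hwin hdim hov hz hc _ => hL η f x₀ s hmax R Hs B hE j v hlow hnR hwin hdim hov hz hc

/-- OPEN REGIME «E» (ELSE ⁄ grazing) in Q8-door currency: binders + `ι ≤ 0`, no floor certificate, no child fit, no landing dip ⇒ a door.
Content: `¬CellF` with `κ ≥ ½` says that on the whole N♯ window either separation fails or the exact END number is `≥ ρ₀‖K‖` — a zero of
`f^{(j)}` NOT roofing `v` sits at Newton distance `≲ 2/‖K‖ ≤ 4y`.  Owners: U (two-body with that neighbour) / C′.  Boundary observable: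
nearest-zero distance ·‖K‖ and `endNumber(ρ₀)/(ρ₀‖K‖)` across the window. -/
def RegE8 : Prop :=
  ∀ (η : ℝ) (f : ℂ → ℂ) (x₀ s hmax R Hs : ℝ) (B : ℕ), EngineHyps5 2 η f x₀ s hmax R Hs B → ∀ (j : ℕ) (v : ℂ),
    IsLowest StTrkDQ η f x₀ s hmax R Hs B j v → ¬ ReadyR2 η f x₀ s hmax R Hs B j v →
    ¬ AllInBandInRangeWindow f x₀ R Hs j v → ¬ Dimple f j v → DiscOverlap f j v →
    iteratedDeriv (j + 1) f v ≠ 0 → CellE f x₀ R Hs j v → Doors8 f x₀ R Hs j v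

/-- PLUG for owner L: a «landing-Taylor law on cell L» (dip ⇒ Taylor numbers in the frame) discharges `RegL8` through door D5's socket. -/
theorem regL8_of_landingTaylorLaw
    (hLT : ∀ (η : ℝ) (f : ℂ → ℂ) (x₀ s hmax R Hs : ℝ) (B : ℕ), EngineHyps5 2 η f x₀ s hmax R Hs B → ∀ (j : ℕ) (v : ℂ),
      IsLowest StTrkDQ η f x₀ s hmax R Hs B j v → ¬ ReadyR2 η f x₀ s hmax R Hs B j v →
      ¬ AllInBandInRangeWindow f x₀ R Hs j v → ¬ Dimple f j v → DiscOverlap f j v →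
      iteratedDeriv (j + 1) f v ≠ 0 → CellL f x₀ R Hs j v → RhW08.LandingDoor.LandingTaylor f x₀ R Hs j) :
    RegL8 := by
  intro η f x₀ s hmax R Hs B hE j v hlow hnR hwin hdim hov hz hL
  have hT := hLT η f x₀ s hmax R Hs B hE j v hlow hnR hwin hdim hov hz hL
  exact Or.inr (Or.inr (Or.inr (Or.inr (Or.inl
    (RhW08.LandingDoor.landingNumbers_of_defect (RhW08.LandingDoor.landingDefect_of_taylor hE.1 hT))))))

/-- Conversely the law of record implies every regime statement (so v7q's SUCC stubs are implied by v6q's `stub_doorAvailLawQ8`). -/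
theorem doorAvailLawQ8_implies_regimes (hL : RhW08.LandingDoor.DoorAvailLawQ8) :
    RegCov8 ∧ RegF8 ∧ RegNb8 ∧ RegL8 ∧ RegE8 :=
  ⟨fun η f x₀ s hmax R Hs B hE j v hlow hnR hwin hdim hov hz _ _ => hL η f x₀ s hmax R Hs B hE j v hlow hnR hwin hdim hov hz,
   fun η f x₀ s hmax R Hs B hE j v hlow hnR hwin hdim hov hz _ => hL η f x₀ s hmax R Hs B hE j v hlow hnR hwin hdim hov hz,
   fun η f x₀ s hmax R Hs B hE j v hlow hnR hwin hdim hov hz _ => hL η f x₀ s hmax R Hs B hE j v hlow hnR hwin hdim hov hz,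
   fun η f x₀ s hmax R Hs B hE j v hlow hnR hwin hdim hov hz _ => hL η f x₀ s hmax R Hs B hE j v hlow hnR hwin hdim hov hz,
   fun η f x₀ s hmax R Hs B hE j v hlow hnR hwin hdim hov hz _ => hL η f x₀ s hmax R Hs B hE j v hlow hnR hwin hdim hov hz⟩

/-! ## §14 THE COMPOSITIONS (sorry-free) -/

/-- ★ LITERAL COVERAGE THEOREM (director CA443 (iii)): the five regime statements give the SUCC law of record. -/
theorem doorAvailLawQ8_of_regimes (hC : RegCov8) (hF : RegF8) (hN : RegNb8) (hL : RegL8) (hX : RegE8) :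
    RhW08.LandingDoor.DoorAvailLawQ8 := by
  intro η f x₀ s hmax R Hs B hE j v hlow hnR hwin hdim hov hz
  rcases cells_cover f x₀ R Hs j v with h | h | h | h | h
  · exact hC η f x₀ s hmax R Hs B hE j v hlow hnR hwin hdim hov hz h (exists_cover_of_coverIndex_pos_frame hE hlow.1 hz h)
  · exact hF η f x₀ s hmax R Hs B hE j v hlow hnR hwin hdim hov hz h
  · exact hN η f x₀ s hmax R Hs B hE j v hlow hnR hwin hdim hov hz h
  · exact hL η f x₀ s hmax R Hs B hE j v hlow hnR hwin hdim hov hz h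
  · exact hX η f x₀ s hmax R Hs B hE j v hlow hnR hwin hdim hov hz h

/-- ★★ COVERAGE THEOREM, SUCCESSOR CURRENCY: the THREE open regime statements close `AntiEscapeCore`; cells F and N♭ are discharged by
the proved regime lemmas, the multiple case by `succ_of_multiple`. -/
theorem antiEscapeCore_of_regimes (hRB : RealCritBoundNSig) (hC : RegCov8) (hL : RegL8) (hX : RegE8) : AntiEscapeCore := by
  intro η f x₀ s hmax R Hs B hE j v hlow hnR hwin hdim hov
  by_cases hz : iteratedDeriv (j + 1) f v = 0
  · exact succ_of_multiple hE hlow.1 hz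
  rcases cells_cover f x₀ R Hs j v with h | h | h | h | h
  · exact succ_of_doors8 hRB hE hlow hnR
      (hC η f x₀ s hmax R Hs B hE j v hlow hnR hwin hdim hov hz h (exists_cover_of_coverIndex_pos_frame hE hlow.1 hz h))
  · exact regime_F hE hlow.1 h
  · exact regime_Nb hE hlow.1 h
  · exact succ_of_doors8 hRB hE hlow hnR (hL η f x₀ s hmax R Hs B hE j v hlow hnR hwin hdim hov hz h)
  · exact succ_of_doors8 hRB hE hlow hnR (hX η f x₀ s hmax R Hs B hE j v hlow hnR hwin hdim hov hz h)

theorem restSuccBotQ_of_regimes (hRB : RealCritBoundNSig) (hC : RegCov8) (hL : RegL8) (hX : RegE8) : RestSuccBotQ :=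
  restSuccBotQ_of_pieces dimpleSig_holds (antiEscape_of_core (antiEscapeCore_of_regimes hRB hC hL hX))

/-- ★★ (v2) COVERAGE THEOREM, SUCCESSOR CURRENCY, with cell L split: the deep part of L is DISCHARGED by the Jensen dip lemma
(`regime_Ldeep`), so the open SUCC statements are `RegCov8`, `RegLedge8`, `RegE8`. -/
theorem antiEscapeCore_of_regimes2 (hRB : RealCritBoundNSig) (hC : RegCov8) (hL : RegLedge8) (hX : RegE8) : AntiEscapeCore := by
  intro η f x₀ s hmax R Hs B hE j v hlow hnR hwin hdim hov
  by_cases hz : iteratedDeriv (j + 1) f v = 0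
  · exact succ_of_multiple hE hlow.1 hz
  rcases cells_cover f x₀ R Hs j v with h | h | h | h | h
  · exact succ_of_doors8 hRB hE hlow hnR
      (hC η f x₀ s hmax R Hs B hE j v hlow hnR hwin hdim hov hz h (exists_cover_of_coverIndex_pos_frame hE hlow.1 hz h))
  · exact regime_F hE hlow.1 h
  · exact regime_Nb hE hlow.1 h
  · by_cases hdeep : LandingDipDeep f x₀ R Hs j v
    · exact regime_Ldeep hE hdeep
    · exact succ_of_doors8 hRB hE hlow hnR (hL η f x₀ s hmax R Hs B hE j v hlow hnR hwin hdim hov hz h hdeep)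
  · exact succ_of_doors8 hRB hE hlow hnR (hX η f x₀ s hmax R Hs B hE j v hlow hnR hwin hdim hov hz h)

theorem restSuccBotQ_of_regimes2 (hRB : RealCritBoundNSig) (hC : RegCov8) (hL : RegLedge8) (hX : RegE8) : RestSuccBotQ :=
  restSuccBotQ_of_pieces dimpleSig_holds (antiEscape_of_core (antiEscapeCore_of_regimes2 hRB hC hL hX))

/-- ★★ (v2) THE CRUX BY NAME from `RegCov8`, `RegLedge8`, `RegE8` and lens-2's rate law (candidate skeleton v8q's composition). -/
theorem TiltedLandingLaw421R_of_regimes2 (hC : RegCov8) (hL : RegLedge8) (hX : RegE8) (hR : RhW08.RateSplit.RateLawsHalfQ) :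
    Summit.RiemannHypothesis.RiemannHypothesis.Theses.EarlyAppointments.TiltedLandingLaw421R :=
  law421Half_of_succ_rate (restSuccBotQ_of_regimes2 RhW08.ClusterQM.realCritBoundNSig_holds hC hL hX)
    (RhW08.RateSplit.restRateBotPQ_half_of_rateLaws hR)

/-- ★★ THE CRUX BY NAME from the three open regimes and lens-2's rate law (candidate skeleton v7q's composition). -/
theorem TiltedLandingLaw421R_of_regimes (hC : RegCov8) (hL : RegL8) (hX : RegE8) (hR : RhW08.RateSplit.RateLawsHalfQ) :
    Summit.RiemannHypothesis.RiemannHypothesis.Theses.EarlyAppointments.TiltedLandingLaw421R :=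
  law421Half_of_succ_rate (restSuccBotQ_of_regimes RhW08.ClusterQM.realCritBoundNSig_holds hC hL hX)
    (RhW08.RateSplit.restRateBotPQ_half_of_rateLaws hR)

/-- The law of record still closes the crux through this file (sanity: v6q ⇒ v7q). -/
theorem TiltedLandingLaw421R_of_doorAvail8' (hL8 : RhW08.LandingDoor.DoorAvailLawQ8) (hR : RhW08.RateSplit.RateLawsHalfQ) :
    Summit.RiemannHypothesis.RiemannHypothesis.Theses.EarlyAppointments.TiltedLandingLaw421R :=
  have h := doorAvailLawQ8_implies_regimes hL8
  TiltedLandingLaw421R_of_regimes h.1 h.2.2.2.1 h.2.2.2.2 hR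

/-! ## §15 CANDIDATE SKELETON v8q (for the lead ⁄ director — this seat registers nothing): three SUCC stubs + lens-2's RATE stub

The ONLY `sorry`s of this file.  Each SUCC stub is STRICTLY WEAKER than `stub_doorAvailLawQ8` of v6q (`doorAvailLawQ8_implies_regimes`,
`regLedge8_of_regL8`); v2 replaces v1's `stub_regL8` by the weaker `stub_regLedge8` (deep dips are proved, `regime_Ldeep`). -/

theorem stub_regCov8 : RegCov8 := by
  sorry

theorem stub_regLedge8 : RegLedge8 := by
  sorry

theorem stub_regE8 : RegE8 := by
  sorry

theorem stub_rateLawsHalfQ : RhW08.RateSplit.RateLawsHalfQ := by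
  sorry

/-- v8q composition: the crux BY NAME. -/
theorem TiltedLandingLaw421R_of :
    Summit.RiemannHypothesis.RiemannHypothesis.Theses.EarlyAppointments.TiltedLandingLaw421R :=
  TiltedLandingLaw421R_of_regimes2 stub_regCov8 stub_regLedge8 stub_regE8 stub_rateLawsHalfQ

end Summit.RiemannHypothesis.RiemannHypothesis.Cruxes.TiltedLandingLaw421R.Lens1
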